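import Literature.Probability.LatticeModels.ClusterExpansionKPBound
import Literature.Probability.LatticeModels.PolymerPressureAnalytic
import Literature.Probability.LatticeModels.TruncatedWeightLipschitz
import Literature.MathematicalPhysics.QuantumFieldTheory.Balaban1983to89.T4OutputRate
import Literature.MathematicalPhysics.QuantumFieldTheory.Balaban1983to89.B13Resummation
import Literature.MathematicalPhysics.QuantumFieldTheory.Dimock2015.AnalyticLipschitz

/-!
# T⁴-continuum spine estimate NE5 (node U3), polymer-activity Lipschitz route:
# the η-rate of the one-step outputs as functionals of the ACTIVITIES

Cell `pub-balaban`, T⁴-continuum fan-out, node U3 / estimate NE5, prover seat P2 (assigned technique: *polymer-activity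
Lipschitz route — bound output differences by activity differences via the printed convergence criteria (Kotecký–Preiss
norm)*).  Companion leaves by the sibling seats: `T4InputCauchyRate` (P1, input interpolation) and `T4BoundaryRate`
(P3, boundary member); the typed target shape is `T4OutputRate.NE5` (node U3's bracket (ii)).

HONEST FRAMING.  This is bookkeeping for the finite-volume T⁴ continuum-limit programme of [Bałaban 1983–89] as audited
by the cell: NO infinite volume, NO mass gap, NOT the Clay problem, and not summit progress — rung "(B)+1" scoping of
what the printed renormalization-group papers do and do not prove about the η → 0 limit.  Nothing in this module
asserts anything about Bałaban's actual functionals: §1–§2, §4, (v2) §5–§6 and (v3) §8a–§8b are theorems about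
abstract polymer gases and normed input spaces (kernel-proved, `[folklore]` = standard cluster-expansion / one-variable
complex analysis), §3, (v2) §7 and (v3) §8c type the HYPOTHESES under
which they yield `T4OutputRate.NE5` and prove the implications.  The conditionals of the cell — (B), (B^μ), BetaPertH —
do not occur in the theorems of this file (pure combinatorics and one-variable complex analysis); they necessarily enter
any INSTANTIATION of the hypothesis shapes `ClusterRep.KPMajorant` / `ClusterRep.PencilKP` (through the window `W` and
the (2.38)-majorant), `ClusterRep.ActivityRate` / `ClusterRep.PencilBudget`, (v3) `ClusterRep.InputKP` / `ClusterRep.InputRate`, and whoever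
discharges those must name them
there.

WHAT IS PRINTED (B13 = [Balaban1988RG2Cluster], quotations from the rendered journal pages).
* p. 14, (2.11): the fluctuation integral as a polymer gas, *"(2.1) = Σ_{{Z_1,…,Z_n}} H(Z_1)…H(Z_n) = 1 +
  Σ_{n=1}^∞ (1/n!) Σ_{(Z_1,…,Z_n)} ∏_{{i,j}, i<j} ζ(Z_i, Z_j) H(Z_1)…H(Z_n), (2.11) where the function ζ(Z, Z′) is
  defined by the condition: ζ(Z, Z′) = 0 if Z ∩ Z′ contains a cube, or a wall of a cube, and ζ(Z, Z′) = 1 otherwise"*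
  (hard-core incompatibility), exponentiated by *"the well-known formula, see [36, 60, 26, 25, 67, 50]"* (2.12),
  and localized: *"E^{(k+1)}(X) = Σ_{n=1}^∞ (1/n!) Σ_{(Z_1,…,Z_n): ∪Z_i = X} ρ^T(Z_1,…,Z_n)H(Z_1)…H(Z_n), (2.13) where
  X ∈ 𝐃_{k+1}"*.
* p. 15: *"The quadratic forms and covariances in H(Z) are analytic functions on the space of configurations (𝐔, 𝐉)
  satisfying the conditions I.(i)–(iii) on the domain Z"*; *"Thus the activities in (2.13), and the whole sum
  E^{(k+1)}(X), are analytic functions of (𝐔, 𝐉), on the space 𝐔^c_{k+1}(X, α₀, α₁). This is the analyticity statement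
  in the inductive assumptions."*; (2.14) = the explicit form of *"a term in the sum over 𝐃, P"* of `H(Z)`.
* (v2) p. 7, (1.22)–(1.23) — the model of every later localization in B13: a COMPLEX interpolation parameter, the
  Cauchy formula, gain = 1/radius, radius = analyticity margin ÷ size of the perturbation: *"we extend the expression in
  (1.10) analytically with respect to t_□ satisfying |t_□|4B₀C₁e^{16κ₁}g_k|B| ≤ ½α₂. Taking t_□ for which the equality
  holds, we get 1/|t_□| = 8B₀C₁e^{16κ₁}α₂⁻¹g_k|B| < 8B₀C₁e^{16κ₁}α₂⁻¹ε₁. (1.22)"*; *"We differentiate it with respect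
  to t_□, at t_□ = 0, and we represent all derivatives by the Cauchy formula"* ((1.23)), *"where the t_□-integration is
  over the circle (1.22), and the σ(Δ)-integrations are over the circles |σ(Δ)| = e^{κ₁}"*; p. 13: *"We localize it
  again by the method used in Sect. 1, introducing the parameters s and differentiating."*; p. 15, after (2.14): *"We
  consider it as an analytic function of (𝐔, 𝐉) in the space 𝐔^c_{k+1}(X, α₀, α₁), and of the complex parameters
  σ(Z), τ."*; p. 16, (2.18): the τ(Y)-radius *"1/|τ(Y)| = E₀ε₁C₁α₄⁻¹M^q exp C₂κ₁ exp(−(1 − 3δ)κd_k(Y))"*.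
* p. 20, Lemma 3: *"|H(Z)| ≤ C₃ε₁ exp(−(1 − 8δ)½Lκ d_{k+1}(Z)). (2.38)"* and *"The above lemma implies that sufficient
  conditions for convergence of the series (2.12), (2.13) are satisfied, see [26, 67, 25, 50]"*.
* p. 21: (2.39), (2.40) and *"|E^{(k+1)}(X)| ≤ O(1)C₃ε₁ exp(−(1 − 10δ)½Lκ d_{k+1}(X)). (2.41)"*, under
  *"(1 − 10δ)½L = 1"* and *"O(1)C₃ε₁ ≤ ½E₀"*.
WHAT IS NOT PRINTED.  B13 bounds ONE run's `E^{(k+1)}(X)` ((2.41)); it never compares the outputs — or the activities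
`H(Z)` of (2.14) p. 15 — of two runs at lattice spacings η and η/L.  That comparison is the cell's NE5; this module reduces
it to a comparison of ACTIVITIES (shape `ClusterRep.ActivityRate`, "NE5-ACT"), which is likewise not printed and is
where the η-dependence of propagators / background minimizers / fluctuation covariances (cell NE2, NE3) must enter.
(v2) B13's complex parameters t_□, s, σ, τ interpolate WITHIN one run (decoupling cubes, switching on small terms); a
PENCIL interpolating the INPUT operators between the two lattice spacings, with Lemma 3 uniform along it (shape
`ClusterRep.PencilKP`, "NE5-PENCIL") and radius = input analyticity margin ÷ input discrepancy (shape
`ClusterRep.PencilBudget`; the discrepancy is the cell's NE2 ∧ NE3), is NOT PRINTED either — it is the printed TYPE of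
mechanism pointed at a non-printed comparison.

WHAT IS KERNEL-PROVED HERE.
* §1 `touchDiffSum_le_of_kp_disc` / `touchDiffSum_le_of_majorant` — the PINNED ACTIVITY-LIPSCHITZ THEOREM for the
  Kotecký–Preiss truncated weights: if two activity families `wA, wB` on a finite volume `L` have a common majorant
  `m` with `‖wA − wB‖ ≤ ε m`, and `2m` satisfies the `d`-weighted KP criterion [KoteckyPreiss1986, (1)] with size
  function `a`, then for every pin `γ ∈ L`
  `Σ_{C ⊆ L, C ι γ} |Φ^T(C; wA) − Φ^T(C; wB)| e^{d(C)} ≤ 4ε a(γ)` — the difference analogue of [KP86, (4)]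
  (tree: `touchSum_le_of_kp`).  Proof: scalarise the finite family of differences by their unit phases, interpolate
  `w_z = wB + z(wA − wB)` over the complex disc `|z| < 1/ε` (where `‖w_z‖ ≤ 2m`, so KP and zero-freeness hold,
  tree `polymerPartitionFunction_ne_zero_of_kp`, and `Φ^T(C; w_z)` is holomorphic, tree
  `differentiableOn_polymerLogZ_param`), bound the scalarised sum by `a(γ)` via [KP86, (4)] at each `w_z`, and apply
  Cauchy's estimate (Mathlib `Complex.norm_deriv_le_of_forall_mem_sphere_norm_le`) plus the mean value inequality.
* §2 `sum_norm_truncatedWeight_sub_le_of_majorant`, `norm_clusterSum_sub_le_of_majorant` — the localized form with an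
  extracted decay `e^{−δ}` (the mechanism of (2.39)–(2.41)), and the one-family decay bound `norm_clusterSum_le_of_kp`.
* §4 `norm_locE_sub_locE_le`, `norm_locE_sub_locE_le_of_small` — the SAME in the printed letters of B13 over the
  catalogue of `B13Resummation` (`locE` = (2.13) in KP form; geometry (1.26)/(2.27)/(2.30) as the hypotheses
  `Ineq126`, `Ineq227`, `VolBound` of `B13FamilySum`): under the hypotheses of `B13Resummation.norm_locE_le_of_small`
  with the smallness halved once more (`2C₃ε₁ · e^{b+1}K₀νc₁ ≤ 1`),
  `|E_A^{(k+1)}(X) − E_B^{(k+1)}(X)| ≤ 8ε · (eνc₁K₀²) · C₃ε₁ · e^{−r₁ d_{k+1}(X)}`, `ε` = the relative distance of the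
  two activity families in the (2.38)-majorant.
* §3 `ClusterRep.ne5_of_activityRate` — over the abstract carriers of `T4OutputRate`: a representation of the paired
  outputs as localized cluster sums of one polymer gas at two activity families (NE5-REP), a KP majorant (NE5-KP), decay
  extraction and a pin budget, and the activity rate NE5-ACT `‖ρA − ρB‖ ≤ cθ^{scale X} m` give
  `T4OutputRate.NE5 EA EB W κ θ (4cA)`; `ClusterRep.decayBound_of_kp` gives `T4OutputRate.DecayBound EB W A κ`
  ((2.41)-shape) from the same data without NE5-ACT.
* (v2) §5 `touchDiffSum_le_of_kp_disc_family` — the PENCIL FORM of the pinned activity-Lipschitz theorem: for ANY family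
  `z ↦ w_z` of activity families, holomorphic polymer by polymer on the disc `‖z‖ < R` (`R > 1`) and satisfying the
  `d`-weighted KP hypothesis with size function `a` UNIFORMLY on the disc,
  `Σ_{C ⊆ L, C ι γ} |Φ^T(C; w_1) − Φ^T(C; w_0)| e^{d(C)} ≤ a(γ)/(R − 1)` (§1 is the affine pencil `wB + z(wA − wB)`,
  `R = 1/ε`, under the doubled majorant); one-variable input `norm_sub_le_div_of_ball` (= the tree's
  `Dimock2015.norm_sub_le_div_of_bound_sphere` on every circle `1 < r < R`, `r ↑ R`); localized corollaries
  `sum_norm_truncatedWeight_sub_le_of_family`, `norm_clusterSum_sub_le_of_family` (`≤ a(γ)e^{−δ}/(R − 1)`).  No factor 4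
  and NO doubling: the pencil is required to stay under the ONE-run majorant, so the KP hypothesis is the one-run one.
* (v2) §6 `sum_coveringFamilies_le_of_anchored` (the anchored (2.39)–(2.41) assembly for any nonnegative cluster
  functional), `anchoredDecay_le_sum` ((2.27)-extraction), `norm_locE_sub_locE_le_of_pencil` / `_of_pencil_small` — in the
  printed letters, under EXACTLY the hypotheses of the one-run kernel `B13Resummation.norm_locE_le` / `norm_locE_le_of_small`
  (nothing halved) holding uniformly along a pencil of radius `Rz > 1`:
  `|E^{(k+1)}_{w_1}(X) − E^{(k+1)}_{w_0}(X)| ≤ (eνc₁K₀²) · C₃ε₁ · e^{−r₁ d_{k+1}(X)} / (Rz − 1)`.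
* (v2) §7 `ClusterRep.ne5_of_pencil` — NE5-REP ∧ NE5-PENCIL (`ClusterRep.PencilKP`: the two runs' activity families are
  the values z = 1, 0 of a pencil holomorphic on `‖z‖ < Rz X` and dominated there by the (2.38)-type majorant `m`, KP for
  `m`) ∧ DECAY ∧ PIN ∧ PENCIL-BUDGET (`ClusterRep.PencilBudget`: `1/(Rz X − 1) ≤ cθ^{scale X}`) ⇒
  `T4OutputRate.NE5 EA EB W κ θ (cA)`; `ClusterRep.activityRate_of_pencil` — the same data give §3's NE5-ACT with the
  same `c` (NE5-ACT ⇐ NE5-PENCIL ∧ PENCIL-BUDGET); `ClusterRep.decayBound_of_pencil`.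
* (v3) §8 INPUT pencils.  §8a `inputPencil pA pB z = pB + z • (pA − pB)` over an abstract complex normed input space,
  `norm_sub_le_div_of_inputBall` / `norm_sub_le_of_inputBall` (`Ψ` holomorphic on `ball pB ϱ`, bounded by `M`,
  `‖pA − pB‖ ≤ rϱ`, `r ≤ ½` ⇒ `‖Ψ pA − Ψ pB‖ ≤ 2Mr`); §8b `norm_sub_le_of_polydisc_pencil` — ONE pencil through a
  polydisc (`‖x_i − y_i‖ ≤ rϱ_i` blockwise ⇒ `‖Φ x − Φ y‖ ≤ 2Mr`: max over blocks instead of the staircase's sum, same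
  hypotheses as `T4InputCauchyRate.norm_sub_le_sum_of_polydisc`); §8c `ClusterRep.LocalPencilKP` (X-dependent pencils;
  `ne5_of_localPencil`), `ClusterRep.InputKP` (activities = holomorphic FUNCTIONS of the two-run inputs on the margin
  ball, under the one-run majorant) ∧ `ClusterRep.InputRate` (‖pA − pB‖ ≤ Dθ^{scale X}·margin) ⇒ the local pencil with
  radius `(Dθ^{scale X})⁻¹` (`localPencilKP_of_inputKP`) and its budget (`pencilBudget_of_window`, window `Dθ^{scale} ≤ ½`),
  hence `ClusterRep.ne5_of_inputKP : … → T4OutputRate.NE5 EA EB W κ θ (2DA)` — the pencil RADIUS is computed, so the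
  v2 wall MI-A″ is kernel modulo the input rate; `activityRate_of_inputKP`, `decayBound_of_inputKP`.

RELATION TO THE TREE'S TWO-FAMILY LAYER.  `Literature.Probability.LatticeModels.TruncatedWeightLipschitz` (the b01
lineage; consumer `B16Exp198TwoRun` for the pieces of B16 (1.98)) proves the GLOBAL weighted-ℓ¹ Lipschitz bound
`Σ_{C ⊆ L} |Φ^T(C; wA) − Φ^T(C; wB)| e^{d(C)} ≤ Σ_{δ ∈ L} |wA δ − wB δ| e^{a δ + d δ}` ([KP86, §3] run along the real
segment) and anchored refinements whose right-hand side is still a sum over the discrepant polymers; with a UNIFORM relative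
rate its per-domain consequences carry the volume factor `#Q` recorded in `B16Exp198TwoRun.sum_exp_mul_norm_locR_sub_le_of_
uniform_rate` ("HONEST VOLUME FACTOR").  The PINNED bound of this file is the complementary statement: its right-hand side is
the KP size `a(γ)` of the pin, exactly as in the one-family estimate (4), so every one-run anchored assembly ((2.39)–(2.41)
here, (1.99) there) goes through VERBATIM for the difference, at the price of the constant 4, of one more halving of the
smallness (KP for `2m`), and of a RELATIVE (majorant-proportional) rate hypothesis — with no volume factor.  The two files
share no declarations beyond the reused `isKPVolume_of_kpd` / `kpd_of_norm_le`.

NOVELTY (D-0021; nearest prior art actually searched — cell file `t4/T4-LITERATURE.md` v14 §1.31 (J), and the texts).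
Nearest printed precedent: the PINNED ACTIVITY-DERIVATIVE objects of the abstract polymer expansion in [Fernández–Procacci
2007, §1]: the formal series *"[∂/∂z_{γ₀} log Ξ_Λ](𝐳) = 1 + Σ_{n≥1} (1/n!) Σ_{(γ₁,…,γ_n)⊂Λⁿ} φ^T(γ₀, γ₁, …, γ_n) z_{γ₁}⋯z_{γ_n}"*
(TP.0), its positive-term majorant `Π_{γ₀}(ρ)` (TP), the domination *"|[∂/∂z_{γ₀} log Ξ_Λ](𝐳)| ≤ … = Π^Λ_{γ₀}(|𝐳|) ≤
Π_{γ₀}(|𝐳|)"* (cdg.2) and `ρ_{γ₀} Π_{γ₀}(ρ) ≤ μ_{γ₀}` (cdg.3), which under Kotecký–Preiss *"becomes Π ≤ e^{a}"* (loc. cit.,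
after (r.kp.1)); together with [KP86, (4)] (the pinned touching-cluster bound = the tree's `touchSum_le_of_kp`) and the
tree's global two-family bound `TruncatedWeightLipschitz` (b01).  Integrating (cdg.2) along a segment bounds
`|log Ξ(w_A) − log Ξ(w_B)|` by `Σ_{γ₀} |Δw_{γ₀}| e^{a(γ₀)}` — a sum over the discrepant polymers, i.e. the GLOBAL shape
again.  Delta of this file: the pin is moved from the differentiated ACTIVITY to the cluster SUPPORT (clusters touching a
fixed γ, ALL activities varied simultaneously at a relative rate ε), and the derivative is taken in ONE global
interpolation parameter z (Cauchy on the disc ‖z‖ < 1/ε where the interpolated family stays under the doubled majorant),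
so the right-hand side is the per-pin KP size `4ε · a(γ) · e^{−δ}` with no sum over γ₀ — the form the per-domain
comparison `T4OutputRate.NE5` consumes.  Claimed grade: new-combination (known ingredients: KP pinned bound, holomorphy of
the finite-volume expansion in the activities, Cauchy), not a new mechanism. [cite: FernandezProcacci2007, (TP.0), (TP), (cdg.1)-(cdg.3), Theorem 1]
(v2 delta.)  The interpolation parameter is freed from the affine line: Dimock's printed difference formula in ONE
complexified input parameter ([Dimock2015] ll. 5647–5679, tree `Dimock2015.AnalyticLipschitz`; used for whole functionals
by the sibling leaf `T4InputCauchyRate`) is run UNDER the pinned Kotecký–Preiss bound, activity family by activity family,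
so the per-domain decay survives and the one-run majorant is never left (constant cA instead of 4cA, no extra halving).
B13's own parameters (1.22)–(1.23), (2.14)–(2.18) are the printed TYPE (within one run).  Nearest Bałaban-school printed
shape of a one-step TWO-RUN comparison (searched: cell `t4/T4-LITERATURE.md` v15 §1.32, corpus keys
`paper:doi-10-1063-1-3329938`, `paper:doi-10-1007-s00023-010-0028-5`): Bałaban–Feldman–Knörrer–Trubowitz 2010, JMP 51
053306 Prop. III.6 (*"‖R_{δ,ε}E − R_{δ,ε/2}Ẽ‖_{2δ} ≤ 2^{36}e^{18K_j}εδ²… + q‖E − Ẽ‖_δ"*) and AHP 11 Thms III.27/III.28 —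
norms of analytic functions with an amplification factor q, parabolic scalar setting, no polymer-level pencil; a SHAPE
precedent, not an input.  Claimed grade for v2: variant of v1 (same ingredients, sharper hypothesis placement).
(v3 delta.)  None claimed beyond bookkeeping: the input pencil IS Dimock's device and the sibling leaf's setting
(`T4InputCauchyRate`, polydiscs of input blocks); v3 only (i) composes it with the pinned pencil bound so that the pencil
radius is margin ÷ discrepancy by a one-line computation, and (ii) records that one pencil through a polydisc pays the
MAXIMUM of the blockwise relative discrepancies where the blockwise staircase pays their SUM.  Grade: variant.

VERSIONS.  v1 (p184343, commit 35aa94733820, 779 l.).  v1.1 (p184361, commit 719b343342c8): DOCFIX only — the locator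
of (2.14) is p. 15 (v1 wrote p. 14 in two docstrings), two p. 15 sentences quoted verbatim; no declaration changed.
v1.2 (p184443, commit ffd701ea58c3): DOCFIX only — the NOVELTY paragraph above (D-0021), answering
`t4/T4-LITERATURE.md` v14 §1.31 (J); no declaration changed.  v1.3 (this file): DOCFIX only, answering the pv05-g10
XREAD of v1.2 (cell GAPS C-pv05g10-10): M1 — the (2.11) display of p. 14 is now quoted verbatim (v1–v1.2 dropped the
leading «1 +» and contracted the pair product ∏_{i<j} ζ(Z_i, Z_j) into a multi-argument ζ); D1 — (2.27) is located on
p. 18 (v1–v1.2 wrote p. 17 in the `ClusterRep.DecayExtract` docstring); advisory A-i — the one-line REDUCTION summary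
below now also names the second non-printed (bookkeeping) input NE5-REP(two-run); no declaration changed (p184664,
commit 3f10ad2e3a23, 813 l.).  v2 (p184808, commit 316beca058f9, 1420 l.): ADDITIVE — one new import (`Dimock2015.AnalyticLipschitz`, already
imported by `T4InputCauchyRate` / `T4CouplingAnalyticity` / `T4BoundaryCarrier`), new §5–§7 appended after v1.3's last
declaration (14 declarations: `norm_sub_le_div_of_ball`, `touchDiffSum_le_of_kp_disc_family`,
`sum_norm_truncatedWeight_sub_le_touchDiffSum`, `sum_norm_truncatedWeight_sub_le_of_family`,
`norm_clusterSum_sub_le_of_family`, `sum_coveringFamilies_le_of_anchored`, `anchoredDecay_le_sum`,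
`norm_locE_sub_locE_le_of_pencil`, `norm_locE_sub_locE_le_of_pencil_small`, `ClusterRep.PencilKP`,
`ClusterRep.PencilBudget`, `ClusterRep.decayBound_of_pencil`, `ClusterRep.ne5_of_pencil`,
`ClusterRep.activityRate_of_pencil`), this header extended; every v1.3 declaration unchanged (consumer by name:
`T4FlagMemory` uses `norm_locE_sub_locE_le`).  v3 (this file): ADDITIVE — no new import; new §8 appended after v2's
last declaration (21 declarations: `inputPencil`, `inputPencil_zero`, `inputPencil_one`, `differentiable_inputPencil`,
`inputPencil_mem_ball`, `differentiableOn_comp_inputPencil`, `norm_sub_le_div_of_inputBall`, `norm_sub_le_of_inputBall`,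
`inputPencil_mem_polydisc`, `norm_sub_le_of_polydisc_pencil`, `ClusterRep.LocalPencilKP`,
`ClusterRep.localPencilKP_of_pencilKP`, `ClusterRep.ne5_of_localPencil`, `ClusterRep.activityRate_of_localPencil`,
`ClusterRep.InputKP`, `ClusterRep.InputRate`, `ClusterRep.localPencilKP_of_inputKP`, `ClusterRep.pencilBudget_of_window`,
`ClusterRep.ne5_of_inputKP`, `ClusterRep.activityRate_of_inputKP`, `ClusterRep.decayBound_of_inputKP`), this header
extended; every v2 declaration unchanged (p184907, commit aca00fa6ae0e, 1794 l.).  v3.1 (this file): DOCFIX only,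
answering the pv03-g10 XREAD of v2 → v3 (cell GAPS C-pv03-54): D1 — the docstring of
`sum_coveringFamilies_le_of_anchored` (§6) now quotes the printed locus of (2.39)–(2.41) verbatim (pp. 20–21) and
withdraws two unlocated fragments of the v2/v3 composite quotation; plus a CAVEAT paragraph in the docstring of
`ClusterRep.InputRate` (§8c) recording the sibling seat's caution on coupling-history inputs; no declaration changed
(every `def` / `theorem` / `structure` byte-identical to v3).

REDUCTION RECORDED FOR THE CARVER.  NE5 ⇐ NE5-REP ∧ NE5-KP ∧ DECAY ∧ PIN ∧ NE5-ACT (this file, kernel), with NE5-KP's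
printed support = (2.38) + the convergence sentence p. 20 (tree `B13Resummation.kp_condition` certifies (2.38) ⇒ KP in
the printed letters) and NE5-ACT NOT PRINTED — the residual crux of this route, typed as `ClusterRep.ActivityRate`.
The TWO-RUN reading of NE5-REP (both runs' outputs as localized cluster sums of ONE polymer system at two activity
families, `ClusterRep.Represents`) is the second non-printed input — bookkeeping, not an estimate: (2.13) p. 14 is
printed for one run; see the `Represents` docstring.
(v2)  NE5 ⇐ NE5-REP ∧ NE5-PENCIL ∧ DECAY ∧ PIN ∧ PENCIL-BUDGET (`ClusterRep.ne5_of_pencil`, constant cA, ONE-run KP), and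
NE5-ACT ⇐ NE5-PENCIL ∧ PENCIL-BUDGET (`ClusterRep.activityRate_of_pencil`).  The v1 wall MI-A = NE5-ACT is thereby typed
one level closer to print as MI-A′ = PENCIL-MAJORANT (Lemma 3's (2.38) uniformly along a pencil of activity families whose
INPUT operators are complex-interpolated between the two runs — printed TYPE: (1.22)–(1.23) p. 7, (2.14)–(2.18) pp. 15–16,
Lemma 3 p. 20; NOT PRINTED as a statement) ∧ MI-A″ = PENCIL-RADIUS (`Rz − 1` ≥ (cθ^{scale})⁻¹: the printed one-run
input analyticity margins — conditions I.(i)–(iii), the space 𝐔^c_{k+1}(X, α₀, α₁) p. 15, the g_j-dependent radii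
recorded as tree `B14.alphaJ` — divided by the two-run input discrepancy at the scale of X, i.e. the cell's NE2 ∧ NE3;
NOT PRINTED).  Honest status unchanged: a kernel REDUCTION with
a sharper typed wall, not an estimate of NE5 (cell T4-DAG §6 verdict on NE5 stands).
(v3)  NE5 ⇐ NE5-REP ∧ INPUT-KP ∧ INPUT-RATE ∧ WINDOW ∧ DECAY ∧ PIN (`ClusterRep.ne5_of_inputKP`, constant 2DA, ONE-run KP):
the pencil radius (MI-A″) is COMPUTED as margin ÷ discrepancy, so the typed wall is exactly INPUT-KP (= MI-A′ in input
form: Lemma 3's (2.38) for the activities as holomorphic functions of the run-dependent inputs on a complex margin ball —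
printed TYPE for the background input, [I] p. 263 and B13 p. 15; NOT PRINTED for the two-run inputs) and INPUT-RATE
(the cell's NE2 ∧ NE3 measured in units of that margin; NOT PRINTED).  Status: still a REDUCTION, not an estimate.
-/

open Finset Metric Set
open scoped BigOperators ComplexConjugate
open Literature.Probability.LatticeModels
open Literature.MathematicalPhysics.QuantumFieldTheory.Balaban1983to89.T4OutputRate
  (Carriers Functional DecayBound NE5)

noncomputable section

namespace Literature.MathematicalPhysics.QuantumFieldTheory.Balaban1983to89.T4ActivityLipschitz

/-! ## §0. The unit phase of a complex number -/

/-- The unit "co-phase" `conj Δ / |Δ|` of a complex number (`0` for `Δ = 0`): `phaseOf Δ * Δ = |Δ|`, `‖phaseOf Δ‖ ≤ 1`.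
Used to scalarise a finite family of differences. [folklore] -/
def phaseOf (Δ : ℂ) : ℂ := conj Δ / (‖Δ‖ : ℂ)

/-- `phaseOf Δ * Δ = |Δ|`. [folklore] -/
theorem phaseOf_mul_self (Δ : ℂ) : phaseOf Δ * Δ = (‖Δ‖ : ℂ) := by
  unfold phaseOf
  rcases eq_or_ne Δ 0 with h | h
  · simp [h]
  · have hn : (‖Δ‖ : ℂ) ≠ 0 := by exact_mod_cast norm_ne_zero_iff.2 h
    rw [div_mul_eq_mul_div, Complex.conj_mul', pow_two, mul_div_assoc, div_self hn, mul_one]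

/-- `‖phaseOf Δ‖ ≤ 1`. [folklore] -/
theorem norm_phaseOf_le_one (Δ : ℂ) : ‖phaseOf Δ‖ ≤ 1 := by
  unfold phaseOf
  rcases eq_or_ne Δ 0 with h | h
  · simp [h]
  · rw [norm_div, Complex.norm_conj, Complex.norm_real, Real.norm_of_nonneg (norm_nonneg _),
      div_self (norm_ne_zero_iff.2 h)]

/-! ## §1. The pinned activity-Lipschitz theorem for Kotecký–Preiss truncated weights -/

section PolymerGas

variable {P : Type*}

/-- The complex line of activities through `wB` (at `z = 0`) and `wA` (at `z = 1`):
`w_z(γ) = wB(γ) + z (wA(γ) − wB(γ))`.  (The real segment `z = s ∈ [0,1]` is the tree's `activitySegment`.) [folklore] -/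
def activityLine (wA wB : P → ℂ) (z : ℂ) : P → ℂ := fun γ => wB γ + z * (wA γ - wB γ)

/-- Evaluation of the activity line. [folklore] -/
@[simp] theorem activityLine_apply (wA wB : P → ℂ) (z : ℂ) (γ : P) :
    activityLine wA wB z γ = wB γ + z * (wA γ - wB γ) := rfl

/-- `w_0 = wB`. [folklore] -/
@[simp] theorem activityLine_zero (wA wB : P → ℂ) : activityLine wA wB 0 = wB := by
  funext γ; simp [activityLine]

/-- `w_1 = wA`. [folklore] -/
@[simp] theorem activityLine_one (wA wB : P → ℂ) : activityLine wA wB 1 = wA := by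
  funext γ; simp [activityLine]

/-- Norm bound along the line: `‖w_z(γ)‖ ≤ ‖wB γ‖ + ‖z‖ ‖wA γ − wB γ‖`. [folklore] -/
theorem norm_activityLine_le (wA wB : P → ℂ) (z : ℂ) (γ : P) :
    ‖activityLine wA wB z γ‖ ≤ ‖wB γ‖ + ‖z‖ * ‖wA γ - wB γ‖ := by
  rw [activityLine_apply]
  exact (norm_add_le _ _).trans (by rw [norm_mul])

variable [DecidableEq P] {inc : P → P → Prop} [DecidableRel inc]

variable (inc) in
/-- The pinned, decay-weighted ℓ¹-distance of the truncated weights of two activity families: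
`Σ_{C ⊆ L, C ι γ} |Φ^T(C; wA) − Φ^T(C; wB)| e^{d(C)}` (the left-hand side of [KP86, (4)/(S)] for the DIFFERENCE).
[folklore] -/
def touchDiffSum (wA wB : P → ℂ) (d : P → ℝ) (L : Finset P) (γ : P) : ℝ :=
  ∑ C ∈ L.powerset with KPTouches inc C γ,
    ‖truncatedWeight inc wA C - truncatedWeight inc wB C‖ * Real.exp (∑ γ' ∈ C, d γ')

/-- `touchDiffSum ≥ 0`. [folklore] -/
theorem touchDiffSum_nonneg (wA wB : P → ℂ) (d : P → ℝ) (L : Finset P) (γ : P) :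
    0 ≤ touchDiffSum inc wA wB d L γ :=
  Finset.sum_nonneg fun _ _ => mul_nonneg (norm_nonneg _) (Real.exp_nonneg _)

/-- `touchDiffSum` is symmetric-free bounded by the two `touchSum`s (triangle inequality). [folklore] -/
theorem touchDiffSum_le_touchSum_add (wA wB : P → ℂ) (d : P → ℝ) (L : Finset P) (γ : P) :
    touchDiffSum inc wA wB d L γ ≤ touchSum inc wA d L γ + touchSum inc wB d L γ := by
  unfold touchDiffSum touchSum
  rw [← Finset.sum_add_distrib]
  refine Finset.sum_le_sum fun C _ => ?_
  rw [← add_mul]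
  exact mul_le_mul_of_nonneg_right (norm_sub_le _ _) (Real.exp_nonneg _)

omit [DecidableEq P] in
/-- Majorant monotonicity of the weighted KP hypothesis: `‖w‖ ≤ m ≤ 2m` on `L`. [folklore] -/
theorem kpWeighted_of_majorant {w : P → ℂ} {m a d : P → ℝ} {L : Finset P}
    (hw : ∀ γ ∈ L, ‖w γ‖ ≤ m γ)
    (hKP : ∀ γ ∈ L, ∑ γ' ∈ L with inc γ' γ, 2 * m γ' * Real.exp (a γ' + d γ') ≤ a γ) :
    ∀ γ ∈ L, ∑ γ' ∈ L with inc γ' γ, ‖w γ'‖ * Real.exp (a γ' + d γ') ≤ a γ :=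
  kpd_of_norm_le (ω := fun γ => 2 * m γ) (fun γ hγ => by
    have h0 : 0 ≤ m γ := (norm_nonneg _).trans (hw γ hγ)
    linarith [hw γ hγ]) hKP

/-- **Pinned activity-Lipschitz bound for the truncated weights — disc form.**  Let `inc` be reflexive and symmetric,
`a, d ≥ 0`, `0 < r`, `r + 1 < R`, and suppose the `d`-weighted Kotecký–Preiss hypothesis of [KP86, (S)] holds in the
finite volume `L` for EVERY activity `w_z = wB + z (wA − wB)` of the complex disc `‖z‖ < R`.  Then for `γ ∈ L`
`Σ_{C ⊆ L, C ι γ} |Φ^T(C; wA) − Φ^T(C; wB)| e^{d(C)} ≤ a(γ) / r`.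
Proof (kernel): scalarise with the unit phases `u_C` of the differences, `G(z) = Σ_C e^{d(C)} u_C Φ^T(C; w_z)`; by the
tree's KP estimate `touchSum_le_of_kp`, `|G(z)| ≤ a(γ)` on the disc; `G` is holomorphic there (`Φ^T` is a finite Möbius
sum of the KP logarithms, holomorphic in the activities on the zero-free region, `differentiableOn_polymerLogZ_param`);
Cauchy's estimate on the circles `|z − x| = r`, `‖x‖ ≤ 1`, gives `‖G′(x)‖ ≤ a(γ)/r`, and the mean value inequality on the
unit disc gives `G(1) − G(0) = Σ_C e^{d(C)} |Φ^T(C; wA) − Φ^T(C; wB)| ≤ a(γ)/r`. [folklore] -/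
theorem touchDiffSum_le_of_kp_disc [Std.Refl inc] [Std.Symm inc] {wA wB : P → ℂ} {a d : P → ℝ}
    (ha : ∀ γ, 0 ≤ a γ) (hd : ∀ γ, 0 ≤ d γ) {L : Finset P} {r R : ℝ} (hr : 0 < r) (hrR : r + 1 < R)
    (hKP : ∀ z : ℂ, ‖z‖ < R → ∀ γ ∈ L,
      ∑ γ' ∈ L with inc γ' γ, ‖activityLine wA wB z γ'‖ * Real.exp (a γ' + d γ') ≤ a γ)
    {γ : P} (hγ : γ ∈ L) :
    touchDiffSum inc wA wB d L γ ≤ a γ / r := by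
  -- the scalarised generating function
  obtain ⟨G, hGdef⟩ : ∃ G : ℂ → ℂ, G = fun z => ∑ C ∈ L.powerset with KPTouches inc C γ,
      (Real.exp (∑ γ' ∈ C, d γ') : ℂ) * phaseOf (truncatedWeight inc wA C - truncatedWeight inc wB C) *
        truncatedWeight inc (activityLine wA wB z) C := ⟨_, rfl⟩
  -- (1) zero-freeness of all rays of all sub-volumes along the disc (KP, [KP86, Theorem])
  have hZ : ∀ z ∈ ball (0 : ℂ) R, ∀ B : Finset P, B ⊆ L → ∀ t ∈ Set.Icc (0 : ℝ) 1,
      polymerPartitionFunction inc (fun γ' => (t : ℂ) * activityLine wA wB z γ') B ≠ 0 := by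
    intro z hz B hB t ht
    have hKPz : IsKPVolume inc (activityLine wA wB z) a L :=
      isKPVolume_of_kpd hd (hKP z (mem_ball_zero_iff.1 hz))
    have hKPt : IsKPVolume inc (fun γ' => (t : ℂ) * activityLine wA wB z γ') a L := by
      intro γ₀ hγ₀
      refine le_trans (Finset.sum_le_sum fun γ' _ => ?_) (hKPz γ₀ hγ₀)
      unfold kpTerm
      refine mul_le_mul_of_nonneg_right ?_ (Real.exp_nonneg _)
      rw [norm_mul, Complex.norm_real, Real.norm_eq_abs, abs_of_nonneg ht.1]
      exact mul_le_of_le_one_left (norm_nonneg _) ht.2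
    exact polymerPartitionFunction_ne_zero_of_kp hKPt hB
  -- (2) `G` is holomorphic on the disc
  have hGdiff : DifferentiableOn ℂ G (ball (0 : ℂ) R) := by
    rw [hGdef]
    refine DifferentiableOn.fun_sum fun C hC => ?_
    have hCL : C ⊆ L := Finset.mem_powerset.1 (Finset.mem_filter.1 hC).1
    refine DifferentiableOn.const_mul ?_ _
    show DifferentiableOn ℂ (fun z => truncatedWeight inc (activityLine wA wB z) C) (ball 0 R)
    unfold truncatedWeight
    refine DifferentiableOn.fun_sum fun B hB => ?_
    have hBL : B ⊆ L := (Finset.mem_powerset.1 hB).trans hCL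
    refine DifferentiableOn.const_mul ?_ _
    exact differentiableOn_polymerLogZ_param (v := fun z => activityLine wA wB z) B isOpen_ball
      (fun γ' _ => by simp only [activityLine_apply]; fun_prop) (fun z hz t ht => hZ z hz B hBL t ht)
  -- (3) `|G z| ≤ a γ` on the disc (KP estimate (4) at each `w_z`)
  have hGle : ∀ z : ℂ, ‖z‖ < R → ‖G z‖ ≤ a γ := by
    intro z hz
    rw [hGdef]
    calc ‖∑ C ∈ L.powerset with KPTouches inc C γ,
            (Real.exp (∑ γ' ∈ C, d γ') : ℂ) * phaseOf (truncatedWeight inc wA C - truncatedWeight inc wB C) *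
              truncatedWeight inc (activityLine wA wB z) C‖
        ≤ ∑ C ∈ L.powerset with KPTouches inc C γ,
            ‖(Real.exp (∑ γ' ∈ C, d γ') : ℂ) * phaseOf (truncatedWeight inc wA C - truncatedWeight inc wB C) *
              truncatedWeight inc (activityLine wA wB z) C‖ := norm_sum_le _ _
      _ ≤ ∑ C ∈ L.powerset with KPTouches inc C γ,
            ‖truncatedWeight inc (activityLine wA wB z) C‖ * Real.exp (∑ γ' ∈ C, d γ') := by
          refine Finset.sum_le_sum fun C _ => ?_
          rw [norm_mul, norm_mul, Complex.norm_real, Real.norm_of_nonneg (Real.exp_nonneg _)]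
          have h1 := norm_phaseOf_le_one (truncatedWeight inc wA C - truncatedWeight inc wB C)
          have he := Real.exp_nonneg (∑ γ' ∈ C, d γ')
          have hn := norm_nonneg (truncatedWeight inc (activityLine wA wB z) C)
          nlinarith [mul_nonneg he hn]
      _ = touchSum inc (activityLine wA wB z) d L γ := rfl
      _ ≤ a γ := touchSum_le_of_kp ha hd (hKP z hz) hγ
  -- (4) Cauchy's estimate at the points of the closed unit disc
  have hderiv : ∀ x ∈ closedBall (0 : ℂ) 1, ‖deriv G x‖ ≤ a γ / r := by
    intro x hx
    have hx1 : ‖x‖ ≤ 1 := mem_closedBall_zero_iff.1 hx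
    have hsub : closedBall x r ⊆ ball (0 : ℂ) R := by
      intro z hz
      rw [mem_closedBall, dist_eq_norm] at hz
      rw [mem_ball_zero_iff]
      calc ‖z‖ = ‖(z - x) + x‖ := by rw [sub_add_cancel]
        _ ≤ ‖z - x‖ + ‖x‖ := norm_add_le _ _
        _ ≤ r + 1 := add_le_add hz hx1
        _ < R := hrR
    have hdc : DiffContOnCl ℂ G (ball x r) :=
      (hGdiff.mono (closure_ball_subset_closedBall.trans hsub)).diffContOnCl
    exact Complex.norm_deriv_le_of_forall_mem_sphere_norm_le hr hdc fun z hz =>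
      hGle z (mem_ball_zero_iff.1 (hsub (sphere_subset_closedBall hz)))
  -- (5) the mean value inequality on the (convex) closed unit disc
  have h0 : (0 : ℂ) ∈ closedBall (0 : ℂ) 1 := mem_closedBall_zero_iff.2 (by simp)
  have h1 : (1 : ℂ) ∈ closedBall (0 : ℂ) 1 := mem_closedBall_zero_iff.2 (by simp)
  have hmv := (convex_closedBall (0 : ℂ) 1).norm_image_sub_le_of_norm_deriv_le
    (fun x hx => hGdiff.differentiableAt (isOpen_ball.mem_nhds (mem_ball_zero_iff.2
      (lt_of_le_of_lt (mem_closedBall_zero_iff.1 hx) (by linarith)))))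
    hderiv h0 h1
  -- (6) `G 1 - G 0` is the (real) pinned difference sum
  have hG10 : G 1 - G 0 = ((touchDiffSum inc wA wB d L γ : ℝ) : ℂ) := by
    rw [hGdef]
    simp only [activityLine_one, activityLine_zero]
    rw [← Finset.sum_sub_distrib, touchDiffSum, Complex.ofReal_sum]
    refine Finset.sum_congr rfl fun C _ => ?_
    rw [← mul_sub, mul_assoc, phaseOf_mul_self, Complex.ofReal_mul, mul_comm]
  rw [sub_zero, norm_one, mul_one, hG10, Complex.norm_real,
    Real.norm_of_nonneg (touchDiffSum_nonneg wA wB d L γ)] at hmv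
  exact hmv

/-- **Pinned activity-Lipschitz bound — majorant form.**  If on `L` both families are dominated by a majorant `m`,
`‖wA − wB‖ ≤ ε m`, and the DOUBLED majorant `2m` satisfies the `d`-weighted KP hypothesis with size function `a`,
then `Σ_{C ⊆ L, C ι γ} |Φ^T(C; wA) − Φ^T(C; wB)| e^{d(C)} ≤ 4 ε a(γ)`.
(For `ε < 1/2`: the disc form with `R = 1/ε`, `r = 1/(2ε)`, since `‖w_z‖ ≤ m + ‖z‖ ε m ≤ 2m`; for `ε ≥ 1/2`: the
triangle inequality and [KP86, (4)] for each family.) [folklore] -/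
theorem touchDiffSum_le_of_majorant [Std.Refl inc] [Std.Symm inc] {wA wB : P → ℂ} {m a d : P → ℝ}
    (ha : ∀ γ, 0 ≤ a γ) (hd : ∀ γ, 0 ≤ d γ) {L : Finset P} {ε : ℝ} (hε : 0 ≤ ε)
    (hA : ∀ γ ∈ L, ‖wA γ‖ ≤ m γ) (hB : ∀ γ ∈ L, ‖wB γ‖ ≤ m γ)
    (hAB : ∀ γ ∈ L, ‖wA γ - wB γ‖ ≤ ε * m γ)
    (hKP : ∀ γ ∈ L, ∑ γ' ∈ L with inc γ' γ, 2 * m γ' * Real.exp (a γ' + d γ') ≤ a γ)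
    {γ : P} (hγ : γ ∈ L) :
    touchDiffSum inc wA wB d L γ ≤ 4 * ε * a γ := by
  rcases lt_or_ge ε (1 / 2) with hlt | hge
  · rcases eq_or_lt_of_le hε with h0 | hpos
    · -- ε = 0 : the two families agree on `L`
      have hS : touchDiffSum inc wA wB d L γ = 0 := by
        unfold touchDiffSum
        refine Finset.sum_eq_zero fun C hC => ?_
        have hCL : C ⊆ L := Finset.mem_powerset.1 (Finset.mem_filter.1 hC).1
        have hAB' : truncatedWeight inc wA C = truncatedWeight inc wB C :=
          truncatedWeight_congr fun γ' hγ' => by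
            have h := hAB γ' (hCL hγ')
            rw [← h0, zero_mul, norm_le_zero_iff, sub_eq_zero] at h
            exact h
        rw [hAB', sub_self, norm_zero, zero_mul]
      rw [hS, ← h0]
      simp
    · -- 0 < ε < 1/2 : disc of radius 1/ε
      have hrR : 1 / (2 * ε) + 1 < 1 / ε := by
        have hne : ε ≠ 0 := hpos.ne'
        have h2 : 1 / ε = 1 / (2 * ε) + 1 / (2 * ε) := by field_simp; ring
        rw [h2, add_lt_add_iff_left, one_lt_div (by positivity)]
        linarith
      have hdisc : ∀ z : ℂ, ‖z‖ < 1 / ε → ∀ γ₀ ∈ L,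
          ∑ γ' ∈ L with inc γ' γ₀, ‖activityLine wA wB z γ'‖ * Real.exp (a γ' + d γ') ≤ a γ₀ := by
        intro z hz γ₀ hγ₀
        refine le_trans (Finset.sum_le_sum fun γ' hγ' => ?_) (hKP γ₀ hγ₀)
        have hγ'L : γ' ∈ L := (Finset.mem_filter.1 hγ').1
        refine mul_le_mul_of_nonneg_right ?_ (Real.exp_nonneg _)
        have hm0 : 0 ≤ m γ' := (norm_nonneg _).trans (hB γ' hγ'L)
        calc ‖activityLine wA wB z γ'‖ ≤ ‖wB γ'‖ + ‖z‖ * ‖wA γ' - wB γ'‖ := norm_activityLine_le _ _ _ _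
          _ ≤ m γ' + (1 / ε) * (ε * m γ') := by
              refine add_le_add (hB γ' hγ'L) ?_
              exact mul_le_mul hz.le (hAB γ' hγ'L) (norm_nonneg _) (by positivity)
          _ = 2 * m γ' := by field_simp; ring
      have hmain := touchDiffSum_le_of_kp_disc ha hd (by positivity) hrR hdisc hγ
      calc touchDiffSum inc wA wB d L γ ≤ a γ / (1 / (2 * ε)) := hmain
        _ = 2 * ε * a γ := by field_simp
        _ ≤ 4 * ε * a γ := by nlinarith [ha γ]
  · -- ε ≥ 1/2 : triangle inequality
    calc touchDiffSum inc wA wB d L γ ≤ touchSum inc wA d L γ + touchSum inc wB d L γ :=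
          touchDiffSum_le_touchSum_add _ _ _ _ _
      _ ≤ a γ + a γ := add_le_add (touchSum_le_of_kp ha hd (kpWeighted_of_majorant hA hKP) hγ)
          (touchSum_le_of_kp ha hd (kpWeighted_of_majorant hB hKP) hγ)
      _ ≤ 4 * ε * a γ := by nlinarith [ha γ]

/-! ## §2. Localized cluster sums: the decay bound and the Lipschitz bound -/

variable (inc) in
/-- The localized cluster sum over a prescribed finite family `𝒞` of finite sets of polymers:
`E_w(𝒞) = Σ_{C ∈ 𝒞} Φ^T(C; w)` — for `𝒞 = {C : ∪_{Z∈C} Z = X}` this is the X-localized part of `log Ξ`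
(Bałaban's (2.13) in Kotecký–Preiss form; the tree's `B13Resummation.locE` is the case `𝒞 = coveringFamilies univ cubes X`).
[folklore] -/
def clusterSum (w : P → ℂ) (𝒞 : Finset (Finset P)) : ℂ := ∑ C ∈ 𝒞, truncatedWeight inc w C

/-- `E_w(𝒞)` depends only on the activities of the polymers occurring in `𝒞`. [folklore] -/
theorem clusterSum_congr {w w' : P → ℂ} {𝒞 : Finset (Finset P)} (h : ∀ C ∈ 𝒞, ∀ γ ∈ C, w γ = w' γ) :
    clusterSum inc w 𝒞 = clusterSum inc w' 𝒞 :=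
  Finset.sum_congr rfl fun C hC => truncatedWeight_congr (h C hC)

/-- **Pinned decay bound, sum of norms** (the engine of Bałaban's (2.39)–(2.41) in [KP86] form): if every `C ∈ 𝒞`
lies in the KP volume `L`, touches the pin `γ ∈ L`, and carries weight `Σ_{γ'∈C} d(γ') ≥ δ`, then
`Σ_{C ∈ 𝒞} |Φ^T(C; w)| ≤ a(γ) e^{−δ}`. [folklore] -/
theorem sum_norm_truncatedWeight_le_of_pin [Std.Refl inc] [Std.Symm inc] {w : P → ℂ} {a d : P → ℝ}
    (ha : ∀ γ, 0 ≤ a γ) (hd : ∀ γ, 0 ≤ d γ) {L : Finset P}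
    (hKP : ∀ γ ∈ L, ∑ γ' ∈ L with inc γ' γ, ‖w γ'‖ * Real.exp (a γ' + d γ') ≤ a γ)
    {𝒞 : Finset (Finset P)} {γ : P} (hγ : γ ∈ L) (hsub : ∀ C ∈ 𝒞, C ⊆ L)
    (hpin : ∀ C ∈ 𝒞, KPTouches inc C γ) {δ : ℝ} (hdec : ∀ C ∈ 𝒞, δ ≤ ∑ γ' ∈ C, d γ') :
    ∑ C ∈ 𝒞, ‖truncatedWeight inc w C‖ ≤ a γ * Real.exp (-δ) := by
  have h𝒞 : 𝒞 ⊆ L.powerset.filter (fun C => KPTouches inc C γ) := fun C hC =>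
    Finset.mem_filter.2 ⟨Finset.mem_powerset.2 (hsub C hC), hpin C hC⟩
  calc ∑ C ∈ 𝒞, ‖truncatedWeight inc w C‖
      ≤ ∑ C ∈ 𝒞, ‖truncatedWeight inc w C‖ * Real.exp (∑ γ' ∈ C, d γ') * Real.exp (-δ) := by
        refine Finset.sum_le_sum fun C hC => ?_
        rw [mul_assoc, ← Real.exp_add]
        have h1 : (1 : ℝ) ≤ Real.exp (∑ γ' ∈ C, d γ' + -δ) := Real.one_le_exp (by linarith [hdec C hC])
        nlinarith [norm_nonneg (truncatedWeight inc w C)]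
    _ = (∑ C ∈ 𝒞, ‖truncatedWeight inc w C‖ * Real.exp (∑ γ' ∈ C, d γ')) * Real.exp (-δ) := by
        rw [Finset.sum_mul]
    _ ≤ touchSum inc w d L γ * Real.exp (-δ) := by
        refine mul_le_mul_of_nonneg_right ?_ (Real.exp_nonneg _)
        unfold touchSum
        exact Finset.sum_le_sum_of_subset_of_nonneg h𝒞 fun C _ _ =>
          mul_nonneg (norm_nonneg _) (Real.exp_nonneg _)
    _ ≤ a γ * Real.exp (-δ) :=
        mul_le_mul_of_nonneg_right (touchSum_le_of_kp ha hd hKP hγ) (Real.exp_nonneg _)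

/-- **Pinned decay bound for the localized cluster sum** (the shape of Bałaban's (2.41)): `|E_w(𝒞)| ≤ a(γ) e^{−δ}`.
[folklore] -/
theorem norm_clusterSum_le_of_kp [Std.Refl inc] [Std.Symm inc] {w : P → ℂ} {a d : P → ℝ}
    (ha : ∀ γ, 0 ≤ a γ) (hd : ∀ γ, 0 ≤ d γ) {L : Finset P}
    (hKP : ∀ γ ∈ L, ∑ γ' ∈ L with inc γ' γ, ‖w γ'‖ * Real.exp (a γ' + d γ') ≤ a γ)
    {𝒞 : Finset (Finset P)} {γ : P} (hγ : γ ∈ L) (hsub : ∀ C ∈ 𝒞, C ⊆ L)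
    (hpin : ∀ C ∈ 𝒞, KPTouches inc C γ) {δ : ℝ} (hdec : ∀ C ∈ 𝒞, δ ≤ ∑ γ' ∈ C, d γ') :
    ‖clusterSum inc w 𝒞‖ ≤ a γ * Real.exp (-δ) :=
  (norm_sum_le _ _).trans (sum_norm_truncatedWeight_le_of_pin ha hd hKP hγ hsub hpin hdec)

/-- **Pinned Lipschitz bound, sum of norms**: under the hypotheses of `touchDiffSum_le_of_majorant` (common majorant
`m`, relative distance `ε`, KP for `2m`) and the pin/decay hypotheses,
`Σ_{C ∈ 𝒞} |Φ^T(C; wA) − Φ^T(C; wB)| ≤ 4 ε a(γ) e^{−δ}`. [folklore] -/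
theorem sum_norm_truncatedWeight_sub_le_of_majorant [Std.Refl inc] [Std.Symm inc] {wA wB : P → ℂ}
    {m a d : P → ℝ} (ha : ∀ γ, 0 ≤ a γ) (hd : ∀ γ, 0 ≤ d γ) {L : Finset P} {ε : ℝ} (hε : 0 ≤ ε)
    (hA : ∀ γ ∈ L, ‖wA γ‖ ≤ m γ) (hB : ∀ γ ∈ L, ‖wB γ‖ ≤ m γ)
    (hAB : ∀ γ ∈ L, ‖wA γ - wB γ‖ ≤ ε * m γ)
    (hKP : ∀ γ ∈ L, ∑ γ' ∈ L with inc γ' γ, 2 * m γ' * Real.exp (a γ' + d γ') ≤ a γ)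
    {𝒞 : Finset (Finset P)} {γ : P} (hγ : γ ∈ L) (hsub : ∀ C ∈ 𝒞, C ⊆ L)
    (hpin : ∀ C ∈ 𝒞, KPTouches inc C γ) {δ : ℝ} (hdec : ∀ C ∈ 𝒞, δ ≤ ∑ γ' ∈ C, d γ') :
    ∑ C ∈ 𝒞, ‖truncatedWeight inc wA C - truncatedWeight inc wB C‖ ≤ 4 * ε * a γ * Real.exp (-δ) := by
  have h𝒞 : 𝒞 ⊆ L.powerset.filter (fun C => KPTouches inc C γ) := fun C hC =>
    Finset.mem_filter.2 ⟨Finset.mem_powerset.2 (hsub C hC), hpin C hC⟩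
  calc ∑ C ∈ 𝒞, ‖truncatedWeight inc wA C - truncatedWeight inc wB C‖
      ≤ ∑ C ∈ 𝒞, ‖truncatedWeight inc wA C - truncatedWeight inc wB C‖ * Real.exp (∑ γ' ∈ C, d γ') *
          Real.exp (-δ) := by
        refine Finset.sum_le_sum fun C hC => ?_
        rw [mul_assoc, ← Real.exp_add]
        have h1 : (1 : ℝ) ≤ Real.exp (∑ γ' ∈ C, d γ' + -δ) := Real.one_le_exp (by linarith [hdec C hC])
        nlinarith [norm_nonneg (truncatedWeight inc wA C - truncatedWeight inc wB C)]
    _ = (∑ C ∈ 𝒞, ‖truncatedWeight inc wA C - truncatedWeight inc wB C‖ * Real.exp (∑ γ' ∈ C, d γ')) *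
          Real.exp (-δ) := by rw [Finset.sum_mul]
    _ ≤ touchDiffSum inc wA wB d L γ * Real.exp (-δ) := by
        refine mul_le_mul_of_nonneg_right ?_ (Real.exp_nonneg _)
        unfold touchDiffSum
        exact Finset.sum_le_sum_of_subset_of_nonneg h𝒞 fun C _ _ =>
          mul_nonneg (norm_nonneg _) (Real.exp_nonneg _)
    _ ≤ 4 * ε * a γ * Real.exp (-δ) :=
        mul_le_mul_of_nonneg_right (touchDiffSum_le_of_majorant ha hd hε hA hB hAB hKP hγ) (Real.exp_nonneg _)

/-- **Pinned Lipschitz bound for localized cluster sums**: `|E_{wA}(𝒞) − E_{wB}(𝒞)| ≤ 4 ε a(γ) e^{−δ}`. [folklore] -/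
theorem norm_clusterSum_sub_le_of_majorant [Std.Refl inc] [Std.Symm inc] {wA wB : P → ℂ} {m a d : P → ℝ}
    (ha : ∀ γ, 0 ≤ a γ) (hd : ∀ γ, 0 ≤ d γ) {L : Finset P} {ε : ℝ} (hε : 0 ≤ ε)
    (hA : ∀ γ ∈ L, ‖wA γ‖ ≤ m γ) (hB : ∀ γ ∈ L, ‖wB γ‖ ≤ m γ)
    (hAB : ∀ γ ∈ L, ‖wA γ - wB γ‖ ≤ ε * m γ)
    (hKP : ∀ γ ∈ L, ∑ γ' ∈ L with inc γ' γ, 2 * m γ' * Real.exp (a γ' + d γ') ≤ a γ)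
    {𝒞 : Finset (Finset P)} {γ : P} (hγ : γ ∈ L) (hsub : ∀ C ∈ 𝒞, C ⊆ L)
    (hpin : ∀ C ∈ 𝒞, KPTouches inc C γ) {δ : ℝ} (hdec : ∀ C ∈ 𝒞, δ ≤ ∑ γ' ∈ C, d γ') :
    ‖clusterSum inc wA 𝒞 - clusterSum inc wB 𝒞‖ ≤ 4 * ε * a γ * Real.exp (-δ) := by
  unfold clusterSum
  rw [← Finset.sum_sub_distrib]
  exact (norm_sum_le _ _).trans
    (sum_norm_truncatedWeight_sub_le_of_majorant ha hd hε hA hB hAB hKP hγ hsub hpin hdec)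

end PolymerGas


/-! ## §4. The printed letters: the activity-Lipschitz form of B13 (2.39)–(2.41) -/

section PrintedLetters

open Literature.MathematicalPhysics.QuantumFieldTheory.Balaban1983to89.B13FamilySum
  (coveringFamilies mem_coveringFamilies Ineq126 VolBound Ineq227)
open Literature.MathematicalPhysics.QuantumFieldTheory.Balaban1983to89.B13Resummation (locE locE_congr kp_condition)

variable {Dom Cube : Type*} [DecidableEq Dom] [DecidableEq Cube] [Fintype Dom]
variable (ι : Dom → Dom → Prop) [DecidableRel ι]

/-- **(2.39)–(2.41), activity-Lipschitz form** (kernel; the companion of `B13Resummation.norm_locE_le` for the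
DIFFERENCE of the X-localized outputs (2.13) of ONE polymer system (2.11) at TWO activity families).  Same geometric
hypotheses as `norm_locE_le` ((1.26) `κ₀, K₀`, volume bound `c₁`, footprint-local incompatibility `reach, ν`, (2.27) for
the covering families of `X` with constant `c`, per-member cost `b ≥ r₁c`, rate `r₁ + 2κ₀ + 1 + τc₁ ≤ R`); both
families bounded by the (2.38)-majorant `A e^{−R d(Z)}` on the polymers `Z ⊂ X`, their difference by `ε` times it, and
the smallness for the DOUBLED majorant `2A e^{b+τc₁} K₀ ν ≤ τ`.  Then
`|E_A^{(k+1)}(X) − E_B^{(k+1)}(X)| ≤ 4ε · τ c₁ K₀ e^{−b} e^{−r₁ d(X)}` — the (2.41) envelope times `4ε`.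
Engine: [KP86] Theorem (tree) + Cauchy's estimate in the interpolation parameter (`touchDiffSum_le_of_majorant`); the
anchored assembly is that of `norm_locE_le` verbatim.  B13 prints only the one-family bound (2.41); the two-family
comparison is NOT PRINTED (cell NE5) — this theorem is what reduces it to a comparison of activities.
[cite: Balaban1988RG2Cluster, (2.39)-(2.41) p.21] -/
theorem norm_locE_sub_locE_le [Std.Refl ι] [Std.Symm ι] {cubes reach : Dom → Finset Cube} {d : Dom → ℝ}
    {wA wB : Dom → ℂ} {A R r₁ κ₀ K₀ c₁ c b τ ν dX ε : ℝ} {X : Finset Cube}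
    (hloc : ∀ Z Z', ι Z' Z → ∃ q ∈ reach Z, q ∈ cubes Z')
    (hreach : ∀ Z, ((reach Z).card : ℝ) ≤ ν * (cubes Z).card)
    (hd : ∀ Z, 0 ≤ d Z) (hA : 0 ≤ A) (hK₀ : 0 ≤ K₀) (hc₁ : 0 ≤ c₁) (hτ : 0 ≤ τ) (hκ₀ : 0 ≤ κ₀)
    (hr₁ : 0 ≤ r₁) (hc : 0 ≤ c) (hb : r₁ * c ≤ b) (hε : 0 ≤ ε)
    (hwA : ∀ Z, cubes Z ⊆ X → ‖wA Z‖ ≤ A * Real.exp (-(R * d Z)))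
    (hwB : ∀ Z, cubes Z ⊆ X → ‖wB Z‖ ≤ A * Real.exp (-(R * d Z)))
    (hAB : ∀ Z, cubes Z ⊆ X → ‖wA Z - wB Z‖ ≤ ε * (A * Real.exp (-(R * d Z))))
    (h126 : Ineq126 (Finset.univ : Finset Dom) cubes d κ₀ K₀)
    (hvol : VolBound (Finset.univ : Finset Dom) cubes d c₁)
    (h227 : Ineq227 (Finset.univ : Finset Dom) cubes d X dX c)
    (hrate : r₁ + 2 * κ₀ + 1 + τ * c₁ ≤ R) (hsmall : 2 * A * Real.exp (b + τ * c₁) * K₀ * ν ≤ τ)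
    (hX : X.Nonempty) :
    ‖locE ι cubes wA X - locE ι cubes wB X‖ ≤
      4 * ε * (τ * c₁ * K₀ * Real.exp (-b) * Real.exp (-(r₁ * dX))) := by
  -- the common majorant and the activities truncated to the polymers inside `X`
  set m : Dom → ℝ := fun Z => A * Real.exp (-(R * d Z)) with hm_def
  have hm0 : ∀ Z, 0 ≤ m Z := fun Z => mul_nonneg hA (Real.exp_nonneg _)
  set wA' : Dom → ℂ := fun Z => if cubes Z ⊆ X then wA Z else 0 with hwA'_def
  set wB' : Dom → ℂ := fun Z => if cubes Z ⊆ X then wB Z else 0 with hwB'_def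
  have hA' : ∀ Z ∈ (Finset.univ : Finset Dom), ‖wA' Z‖ ≤ m Z := by
    intro Z _
    by_cases h : cubes Z ⊆ X
    · simp only [hwA'_def, h, if_true]; exact hwA Z h
    · simp only [hwA'_def, h, if_false, norm_zero]; exact hm0 Z
  have hB' : ∀ Z ∈ (Finset.univ : Finset Dom), ‖wB' Z‖ ≤ m Z := by
    intro Z _
    by_cases h : cubes Z ⊆ X
    · simp only [hwB'_def, h, if_true]; exact hwB Z h
    · simp only [hwB'_def, h, if_false, norm_zero]; exact hm0 Z
  have hAB' : ∀ Z ∈ (Finset.univ : Finset Dom), ‖wA' Z - wB' Z‖ ≤ ε * m Z := by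
    intro Z _
    by_cases h : cubes Z ⊆ X
    · simp only [hwA'_def, hwB'_def, h, if_true]; exact hAB Z h
    · simp only [hwA'_def, hwB'_def, h, if_false, sub_zero, norm_zero]; exact mul_nonneg hε (hm0 Z)
  rw [locE_congr ι (w := wA) (w' := wA') (fun Z hZ => by simp only [hwA'_def, hZ, if_true]),
    locE_congr ι (w := wB) (w' := wB') (fun Z hZ => by simp only [hwB'_def, hZ, if_true])]
  -- Kotecký–Preiss data: `a(Z) = τ #cubes Z`, `d(Z) = (r₁ + (κ₀ + 1)) d(Z) + b`, for the DOUBLED majorant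
  have hb0 : 0 ≤ b := le_trans (mul_nonneg hr₁ hc) hb
  have ha : ∀ Z, 0 ≤ τ * ((cubes Z).card : ℝ) := fun Z => mul_nonneg hτ (Nat.cast_nonneg _)
  have hdK : ∀ Z, 0 ≤ (r₁ + (κ₀ + 1)) * d Z + b := fun Z =>
    add_nonneg (mul_nonneg (by linarith) (hd Z)) hb0
  have h2m : ∀ Z, ‖((2 * m Z : ℝ) : ℂ)‖ ≤ 2 * A * Real.exp (-(R * d Z)) := fun Z => by
    rw [Complex.norm_real, Real.norm_of_nonneg (mul_nonneg zero_le_two (hm0 Z)), hm_def, mul_assoc]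
  have hkp := kp_condition ι hloc hreach hd (A := 2 * A) (by positivity) hK₀ hτ
    (w := fun Z => ((2 * m Z : ℝ) : ℂ)) h2m h126 hvol (s := r₁ + (κ₀ + 1)) (b := b) (by linarith) hsmall
  have hKP2 : ∀ Z ∈ (Finset.univ : Finset Dom), ∑ Z' ∈ Finset.univ with ι Z' Z,
      2 * m Z' * Real.exp (τ * ((cubes Z').card : ℝ) + ((r₁ + (κ₀ + 1)) * d Z' + b)) ≤
        τ * ((cubes Z).card : ℝ) := by
    intro Z _
    calc ∑ Z' ∈ Finset.univ with ι Z' Z,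
          2 * m Z' * Real.exp (τ * ((cubes Z').card : ℝ) + ((r₁ + (κ₀ + 1)) * d Z' + b))
        = ∑ Z' ∈ Finset.univ with ι Z' Z,
          ‖((2 * m Z' : ℝ) : ℂ)‖ * Real.exp (τ * ((cubes Z').card : ℝ) + ((r₁ + (κ₀ + 1)) * d Z' + b)) := by
          refine Finset.sum_congr rfl fun Z' _ => ?_
          rw [Complex.norm_real, Real.norm_of_nonneg (mul_nonneg zero_le_two (hm0 Z'))]
      _ ≤ τ * ((cubes Z).card : ℝ) := hkp Z
  -- the anchor cube
  obtain ⟨q₀, hq₀⟩ := hX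
  set 𝒞 : Finset (Finset Dom) := coveringFamilies (Finset.univ : Finset Dom) cubes X with h𝒞
  have hcover : 𝒞 ⊆ (Finset.univ.filter fun Z => q₀ ∈ cubes Z).biUnion
      (fun Z => 𝒞.filter fun C => Z ∈ C) := by
    intro C hC
    have hU : C.biUnion cubes = X := (mem_coveringFamilies.1 hC).2
    have hq : q₀ ∈ C.biUnion cubes := by rw [hU]; exact hq₀
    obtain ⟨Z, hZC, hqZ⟩ := Finset.mem_biUnion.1 hq
    exact Finset.mem_biUnion.2 ⟨Z, Finset.mem_filter.2 ⟨Finset.mem_univ _, hqZ⟩,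
      Finset.mem_filter.2 ⟨hC, hZC⟩⟩
  -- the pinned Lipschitz bound at each anchoring polymer, with the (2.27)-extraction of the union's decay
  have hanchor : ∀ Z, ∑ C ∈ 𝒞 with Z ∈ C, ‖truncatedWeight ι wA' C - truncatedWeight ι wB' C‖ ≤
      4 * ε * (τ * ((cubes Z).card : ℝ)) * Real.exp (-((r₁ * dX + b) + (κ₀ + 1) * d Z)) := by
    intro Z
    refine sum_norm_truncatedWeight_sub_le_of_majorant (inc := ι) (a := fun Z => τ * ((cubes Z).card : ℝ))
      (d := fun Z => (r₁ + (κ₀ + 1)) * d Z + b) ha hdK hε hA' hB' hAB' hKP2 (Finset.mem_univ Z)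
      (fun C _ => Finset.subset_univ C) (fun C hC => ⟨Z, (Finset.mem_filter.1 hC).2, refl Z⟩)
      (fun C hC => ?_)
    have hC𝒞 : C ∈ 𝒞 := (Finset.mem_filter.1 hC).1
    have hZC : Z ∈ C := (Finset.mem_filter.1 hC).2
    -- goal: `(r₁ dX + b) + (κ₀+1) d Z ≤ Σ_{Z'∈C} ((r₁ + (κ₀+1)) d Z' + b)`
    have h227C : dX + c ≤ ∑ Z' ∈ C, (d Z' + c) := h227 C hC𝒞
    rw [Finset.sum_add_distrib, Finset.sum_const, nsmul_eq_mul] at h227C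
    show (r₁ * dX + b) + (κ₀ + 1) * d Z ≤ ∑ Z' ∈ C, ((r₁ + (κ₀ + 1)) * d Z' + b)
    rw [Finset.sum_add_distrib, Finset.sum_const, nsmul_eq_mul, ← Finset.mul_sum]
    have hcard : (1 : ℝ) ≤ (C.card : ℝ) := by exact_mod_cast Finset.card_pos.2 ⟨Z, hZC⟩
    have hsingle : d Z ≤ ∑ Z' ∈ C, d Z' := Finset.single_le_sum (fun Z' _ => hd Z') hZC
    have hkey : (r₁ + (κ₀ + 1)) * (∑ Z' ∈ C, d Z') + (C.card : ℝ) * b -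
        ((r₁ * dX + b) + (κ₀ + 1) * d Z) =
        r₁ * ((∑ Z' ∈ C, d Z') + (C.card : ℝ) * c - (dX + c)) + (κ₀ + 1) * ((∑ Z' ∈ C, d Z') - d Z) +
          ((C.card : ℝ) - 1) * (b - r₁ * c) := by ring
    have t₁ : 0 ≤ r₁ * ((∑ Z' ∈ C, d Z') + (C.card : ℝ) * c - (dX + c)) :=
      mul_nonneg hr₁ (sub_nonneg.2 h227C)
    have t₂ : 0 ≤ (κ₀ + 1) * ((∑ Z' ∈ C, d Z') - d Z) := mul_nonneg (by linarith) (sub_nonneg.2 hsingle)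
    have t₃ : 0 ≤ ((C.card : ℝ) - 1) * (b - r₁ * c) := mul_nonneg (sub_nonneg.2 hcard) (sub_nonneg.2 hb)
    linarith
  -- per anchoring polymer: `e^{-(P + (κ₀+1)d)} τ #cubes ≤ e^{-P} τ c₁ e^{-κ₀ d}`
  have hper : ∀ Z, 4 * ε * (τ * ((cubes Z).card : ℝ)) * Real.exp (-((r₁ * dX + b) + (κ₀ + 1) * d Z)) ≤
      4 * ε * (Real.exp (-(r₁ * dX + b)) * (τ * c₁) * Real.exp (-(κ₀ * d Z))) := by
    intro Z
    have hv : τ * ((cubes Z).card : ℝ) ≤ τ * c₁ * Real.exp (d Z) := by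
      have h1' : ((cubes Z).card : ℝ) ≤ c₁ * (1 + d Z) := hvol Z (Finset.mem_univ _)
      have h2' : c₁ * (1 + d Z) ≤ c₁ * Real.exp (d Z) :=
        mul_le_mul_of_nonneg_left (by linarith [Real.add_one_le_exp (d Z)]) hc₁
      calc τ * ((cubes Z).card : ℝ) ≤ τ * (c₁ * Real.exp (d Z)) :=
            mul_le_mul_of_nonneg_left (h1'.trans h2') hτ
        _ = τ * c₁ * Real.exp (d Z) := by ring
    have hsplit : Real.exp (-((r₁ * dX + b) + (κ₀ + 1) * d Z)) * Real.exp (d Z) =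
        Real.exp (-(r₁ * dX + b)) * Real.exp (-(κ₀ * d Z)) := by
      rw [← Real.exp_add, ← Real.exp_add]
      congr 1
      ring
    have h4ε : 0 ≤ 4 * ε := by positivity
    rw [mul_assoc (4 * ε)]
    refine mul_le_mul_of_nonneg_left ?_ h4ε
    calc τ * ((cubes Z).card : ℝ) * Real.exp (-((r₁ * dX + b) + (κ₀ + 1) * d Z))
        ≤ (τ * c₁ * Real.exp (d Z)) * Real.exp (-((r₁ * dX + b) + (κ₀ + 1) * d Z)) :=
          mul_le_mul_of_nonneg_right hv (Real.exp_nonneg _)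
      _ = (τ * c₁) * (Real.exp (-((r₁ * dX + b) + (κ₀ + 1) * d Z)) * Real.exp (d Z)) := by ring
      _ = Real.exp (-(r₁ * dX + b)) * (τ * c₁) * Real.exp (-(κ₀ * d Z)) := by rw [hsplit]; ring
  -- assembly
  have hnn : ∀ C : Finset Dom, 0 ≤ ‖truncatedWeight ι wA' C - truncatedWeight ι wB' C‖ := fun C => norm_nonneg _
  calc ‖locE ι cubes wA' X - locE ι cubes wB' X‖
      = ‖∑ C ∈ 𝒞, (truncatedWeight ι wA' C - truncatedWeight ι wB' C)‖ := by
        rw [Finset.sum_sub_distrib]; rfl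
    _ ≤ ∑ C ∈ 𝒞, ‖truncatedWeight ι wA' C - truncatedWeight ι wB' C‖ := norm_sum_le _ _
    _ ≤ ∑ C ∈ (Finset.univ.filter fun Z => q₀ ∈ cubes Z).biUnion (fun Z => 𝒞.filter fun C => Z ∈ C),
          ‖truncatedWeight ι wA' C - truncatedWeight ι wB' C‖ :=
        Finset.sum_le_sum_of_subset_of_nonneg hcover fun C _ _ => hnn C
    _ ≤ ∑ Z ∈ Finset.univ.filter (fun Z => q₀ ∈ cubes Z), ∑ C ∈ 𝒞.filter (fun C => Z ∈ C),
          ‖truncatedWeight ι wA' C - truncatedWeight ι wB' C‖ :=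
        sum_biUnion_le_sum_of_nonneg _ _ _ hnn
    _ ≤ ∑ Z ∈ Finset.univ.filter (fun Z => q₀ ∈ cubes Z),
          4 * ε * (τ * ((cubes Z).card : ℝ)) * Real.exp (-((r₁ * dX + b) + (κ₀ + 1) * d Z)) :=
        Finset.sum_le_sum fun Z _ => hanchor Z
    _ ≤ ∑ Z ∈ Finset.univ.filter (fun Z => q₀ ∈ cubes Z),
          4 * ε * (Real.exp (-(r₁ * dX + b)) * (τ * c₁) * Real.exp (-(κ₀ * d Z))) :=
        Finset.sum_le_sum fun Z _ => hper Z
    _ = 4 * ε * (Real.exp (-(r₁ * dX + b)) * (τ * c₁)) *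
          ∑ Z ∈ Finset.univ.filter (fun Z => q₀ ∈ cubes Z), Real.exp (-(κ₀ * d Z)) := by
        rw [Finset.mul_sum]
        exact Finset.sum_congr rfl fun Z _ => by ring
    _ ≤ 4 * ε * (Real.exp (-(r₁ * dX + b)) * (τ * c₁)) * K₀ :=
        mul_le_mul_of_nonneg_left (h126 q₀) (by positivity)
    _ = 4 * ε * (τ * c₁ * K₀ * Real.exp (-b) * Real.exp (-(r₁ * dX))) := by
        rw [neg_add, Real.exp_add]; ring

/-- **(2.41), activity-Lipschitz kernel form** (companion of `B13Resummation.norm_locE_le_of_small`).  With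
τ = 2A e^{b+1} K₀ ν: if **2A e^{b+1} K₀ ν c₁ ≤ 1** ("ε₁ sufficiently small", one halving beyond (2.41)'s) and
**r₁ + 2κ₀ + 2 ≤ R** ("κ sufficiently large"), then for every nonempty union `X` with (2.27) for its covering families
`|E_A^{(k+1)}(X) − E_B^{(k+1)}(X)| ≤ 8ε · (e ν c₁ K₀²) · A · e^{−r₁ d(X)}`.  In the printed letters (A = C₃ε₁,
R = (1 − 8δ)½Lκ, r₁ = (1 − 10δ)½Lκ, b = 5r₁, p. 21): the (2.41) envelope *"O(1)C₃ε₁ exp(−(1 − 10δ)½Lκd_{k+1}(X))"*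
times `8ε`, where `ε` is the RELATIVE distance of the two activity families measured in the (2.38)-majorant
`C₃ε₁ exp(−(1 − 8δ)½Lκ d_{k+1}(Z))` — the quantity the cell calls NE5-ACT. [cite: Balaban1988RG2Cluster, (2.41) p.21] -/
theorem norm_locE_sub_locE_le_of_small [Std.Refl ι] [Std.Symm ι] {cubes reach : Dom → Finset Cube} {d : Dom → ℝ}
    {wA wB : Dom → ℂ} {A R r₁ κ₀ K₀ c₁ c b ν dX ε : ℝ} {X : Finset Cube}
    (hloc : ∀ Z Z', ι Z' Z → ∃ q ∈ reach Z, q ∈ cubes Z')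
    (hreach : ∀ Z, ((reach Z).card : ℝ) ≤ ν * (cubes Z).card)
    (hd : ∀ Z, 0 ≤ d Z) (hA : 0 ≤ A) (hK₀ : 0 ≤ K₀) (hc₁ : 0 ≤ c₁) (hν : 0 ≤ ν) (hκ₀ : 0 ≤ κ₀)
    (hr₁ : 0 ≤ r₁) (hc : 0 ≤ c) (hb : r₁ * c ≤ b) (hε : 0 ≤ ε)
    (hwA : ∀ Z, cubes Z ⊆ X → ‖wA Z‖ ≤ A * Real.exp (-(R * d Z)))
    (hwB : ∀ Z, cubes Z ⊆ X → ‖wB Z‖ ≤ A * Real.exp (-(R * d Z)))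
    (hAB : ∀ Z, cubes Z ⊆ X → ‖wA Z - wB Z‖ ≤ ε * (A * Real.exp (-(R * d Z))))
    (h126 : Ineq126 (Finset.univ : Finset Dom) cubes d κ₀ K₀)
    (hvol : VolBound (Finset.univ : Finset Dom) cubes d c₁)
    (h227 : Ineq227 (Finset.univ : Finset Dom) cubes d X dX c)
    (hrate : r₁ + 2 * κ₀ + 2 ≤ R) (hsmall : 2 * A * Real.exp (b + 1) * K₀ * ν * c₁ ≤ 1) (hX : X.Nonempty) :
    ‖locE ι cubes wA X - locE ι cubes wB X‖ ≤
      8 * ε * (Real.exp 1 * ν * c₁ * K₀ ^ 2 * A * Real.exp (-(r₁ * dX))) := by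
  set τ : ℝ := 2 * A * Real.exp (b + 1) * K₀ * ν with hτ_def
  have hτ : 0 ≤ τ := by positivity
  have hτc : τ * c₁ ≤ 1 := hsmall
  have hsmall' : 2 * A * Real.exp (b + τ * c₁) * K₀ * ν ≤ τ := by
    have hexp : Real.exp (b + τ * c₁) ≤ Real.exp (b + 1) := Real.exp_le_exp.2 (by linarith)
    calc 2 * A * Real.exp (b + τ * c₁) * K₀ * ν ≤ 2 * A * Real.exp (b + 1) * K₀ * ν := by gcongr
      _ = τ := rfl
  have h := norm_locE_sub_locE_le ι hloc hreach hd hA hK₀ hc₁ hτ hκ₀ hr₁ hc hb hε hwA hwB hAB h126 hvol h227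
    (by linarith) hsmall' hX
  have hcancel : Real.exp (b + 1) * Real.exp (-b) = Real.exp 1 := by
    rw [← Real.exp_add]; congr 1; ring
  calc ‖locE ι cubes wA X - locE ι cubes wB X‖
      ≤ 4 * ε * (τ * c₁ * K₀ * Real.exp (-b) * Real.exp (-(r₁ * dX))) := h
    _ = 8 * ε * ((Real.exp (b + 1) * Real.exp (-b)) * (ν * c₁ * K₀ ^ 2 * A * Real.exp (-(r₁ * dX)))) := by
        rw [hτ_def]; ring
    _ = 8 * ε * (Real.exp 1 * ν * c₁ * K₀ ^ 2 * A * Real.exp (-(r₁ * dX))) := by rw [hcancel]; ring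

end PrintedLetters

/-! ## §3. The reduction of the typed shape `T4OutputRate.NE5` to an activity rate -/

/-- **NE5-REP, the data** (HYPOTHESIS CARRIER, nothing asserted): a realisation of the paired one-step outputs as
localized cluster sums of ONE abstract polymer gas at TWO activity families.  `P` = the polymers of all steps
(Bałaban's localization domains `Z ∈ 𝐃_j`, all j), `inc` = the incompatibility `ζ(Z, Z′) = 0` (reflexive, symmetric),
`vol X` = the finite family of polymers of the step of `X` (the volume in which [KP86, (1)] is required), `clus X` = the
finite families `C` of polymers with `∪_{Z∈C} Z = X` (B13 (2.13)), `pin X` = a polymer of `vol X` touched by every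
`C ∈ clus X` (for (2.13): `X` itself, *"where X ∈ 𝐃_{k+1}"*), `ρA g U` / `ρB g U` = the activities `H(Z)` of run A
(background ALREADY TRANSPORTED from run B's `U`) and of run B.  [cite: Balaban1988RG2Cluster, (2.11)-(2.13) p.14] -/
structure ClusterRep (C : Carriers) where
  /-- polymers (localization domains of all steps) -/
  P : Type
  [decEq : DecidableEq P]
  /-- incompatibility `ζ(Z, Z′) = 0` -/
  inc : P → P → Prop
  [decRel : DecidableRel inc]
  inc_refl : ∀ γ, inc γ γ
  inc_symm : ∀ γ γ', inc γ γ' → inc γ' γ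
  /-- the KP volume of the step of `X` -/
  vol : C.Dom → Finset P
  /-- the families of polymers localizing at `X` (`∪ Z = X`) -/
  clus : C.Dom → Finset (Finset P)
  clus_sub : ∀ X, ∀ K ∈ clus X, K ⊆ vol X
  /-- a pin of `X`: a polymer of the volume touched by every family localizing at `X` -/
  pin : C.Dom → P
  pin_mem : ∀ X, pin X ∈ vol X
  clus_pin : ∀ X, ∀ K ∈ clus X, KPTouches inc K (pin X)
  /-- run-A activities at the transported background, per coupling sequence and run-B background -/
  ρA : (ℕ → ℝ) → C.BgB → P → ℂ
  /-- run-B activities -/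
  ρB : (ℕ → ℝ) → C.BgB → P → ℂ

namespace ClusterRep

variable {C : Carriers} (R : ClusterRep C)

/-- Decidable equality of the representation's polymers (field `decEq`). [folklore] -/
instance instDecEq : DecidableEq R.P := R.decEq

/-- Decidability of the representation's incompatibility (field `decRel`). [folklore] -/
instance instDecRel : DecidableRel R.inc := R.decRel

/-- The representation's incompatibility is reflexive (field `inc_refl`). [folklore] -/
instance instRefl : Std.Refl R.inc := ⟨R.inc_refl⟩

/-- The representation's incompatibility is symmetric (field `inc_symm`). [folklore] -/
instance instSymm : Std.Symm R.inc := ⟨R.inc_symm⟩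

/-- Run A's localized output at `X` (complex; its real part is compared). [folklore] -/
def outA (g : ℕ → ℝ) (U : C.BgB) (X : C.Dom) : ℂ := clusterSum R.inc (R.ρA g U) (R.clus X)

/-- Run B's localized output at `X`. [folklore] -/
def outB (g : ℕ → ℝ) (U : C.BgB) (X : C.Dom) : ℂ := clusterSum R.inc (R.ρB g U) (R.clus X)

/-- **NE5-REP (HYPOTHESIS SHAPE, asserted nowhere)**: the paired output functionals of the carrier ARE the real parts of
the localized cluster sums of the representation — run A's evaluated at the transported background.  Printed support for
the SHAPE (one run, one step): B13 (2.11)–(2.13) p. 14; the two-run identification is NOT PRINTED (cell NE5).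
[cite: Balaban1988RG2Cluster, (2.13) p.14] -/
def Represents (EA : Functional C C.BgA) (EB : Functional C C.BgB) : Prop :=
  (∀ g U X, EA g (C.transport U) X = (R.outA g U X).re) ∧ (∀ g U X, EB g U X = (R.outB g U X).re)

/-- **NE5-KP (HYPOTHESIS SHAPE)**: a common majorant `m` of both activity families whose DOUBLE satisfies the
`d`-weighted Kotecký–Preiss hypothesis [KP86, (1)/(S)] with size function `a` in every step volume, on the window `W`.
Printed support (one run): B13 Lemma 3 (2.38) p. 20 *"|H(Z)| ≤ C₃ε₁ exp(−(1 − 8δ)½Lκ d_{k+1}(Z))"* and p. 20 *"The above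
lemma implies that sufficient conditions for convergence of the series (2.12), (2.13) are satisfied, see [26, 67, 25,
50]"*, with room *"for κ sufficiently large, and ε₁ sufficiently small"* (p. 21) — the tree certifies (2.38) ⇒ KP in the
printed letters in `B13Resummation.kp_condition`; the factor 2 is one more halving of ε₁. [cite: Balaban1988RG2Cluster, Lemma 3 (2.38) p.20] -/
def KPMajorant (W : Set (ℕ → ℝ)) (m : (ℕ → ℝ) → C.BgB → R.P → ℝ) (a d : R.P → ℝ) : Prop :=
  (∀ γ, 0 ≤ a γ) ∧ (∀ γ, 0 ≤ d γ) ∧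
    ∀ g ∈ W, ∀ (U : C.BgB) (X : C.Dom),
      (∀ γ ∈ R.vol X, ‖R.ρA g U γ‖ ≤ m g U γ ∧ ‖R.ρB g U γ‖ ≤ m g U γ) ∧
      (∀ γ ∈ R.vol X, ∑ γ' ∈ R.vol X with R.inc γ' γ, 2 * m g U γ' * Real.exp (a γ' + d γ') ≤ a γ)

/-- **DECAY EXTRACTION (HYPOTHESIS SHAPE)**: the weight `d` carried by a family localizing at `X` is at least `δ X`
(printed engine: B13 (2.27) p. 18 *"Σ_{Y∈𝐃} (d_k(Y) + 5) ≥ d_k(Y₀) + 5"* and p. 21 *"the remaining product is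
estimated using (2.27), and the condition ∪Z_i = X, X is a connected domain"*; tree `B13FamilySum.Ineq227`). [cite: Balaban1988RG2Cluster, (2.39)-(2.40) p.21] -/
def DecayExtract (δ : C.Dom → ℝ) (d : R.P → ℝ) : Prop :=
  ∀ X, ∀ K ∈ R.clus X, δ X ≤ ∑ γ ∈ K, d γ

/-- **PIN BUDGET (HYPOTHESIS SHAPE)**: the KP size of the pin times the extracted decay is within the target envelope
`A e^{−κ d(X)}` (for (2.13) with pin `X`: `a(X) = τ·#cubes(X) ≤ τc₁(1 + d(X))` by the volume bound (2.30), absorbed by a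
unit of decay rate). [cite: Balaban1988RG2Cluster, (2.40)-(2.41) p.21] -/
def PinBudget (a : R.P → ℝ) (δ : C.Dom → ℝ) (A κ : ℝ) : Prop :=
  ∀ X, a (R.pin X) * Real.exp (-(δ X)) ≤ A * Real.exp (-(κ * C.d X))

/-- **NE5-ACT (HYPOTHESIS SHAPE — NOT PRINTED; the residual new estimate of this reduction)**: the RELATIVE η-rate of
the activities: in the step volume of `X`, run A's activity at the transported background and run B's activity differ
by at most `c θ^{scale X}` times the common majorant.  B13 prints uniform BOUNDS for `H(Z)` ((2.38)), never a
comparison of `H(Z)` built at two lattice spacings; this shape is where the η-dependence of propagators / minimizers /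
fluctuation covariances (cell NE2, NE3) must enter, through the explicit form (2.14) p. 15 of the terms of `H(Z)` —
whose printed one-run treatment is itself an operator-replacement perturbation: p. 15 *"In the expression on the
right-hand side we replace the operators by the corresponding operators with σ(Z) = 0, 𝐔 = U, 𝐉 = 0, and we estimate
the error."* (the two-run replacement "run-A operators by run-B operators" is NOT PRINTED).
[cite: Balaban1988RG2Cluster, (2.14) p.15 and Lemma 3 (2.38) p.20] -/
def ActivityRate (W : Set (ℕ → ℝ)) (m : (ℕ → ℝ) → C.BgB → R.P → ℝ) (θ c : ℝ) : Prop :=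
  ∀ g ∈ W, ∀ (U : C.BgB) (X : C.Dom), ∀ γ ∈ R.vol X,
    ‖R.ρA g U γ - R.ρB g U γ‖ ≤ c * θ ^ C.scale X * m g U γ

/-- **The (2.41)-shaped decay bound of run B's outputs from KP** (kernel; the analogue of `B13Resummation.norm_locE_le`
over the abstract representation): NE5-REP ∧ NE5-KP ∧ DECAY ∧ PIN BUDGET ⇒ `T4OutputRate.DecayBound EB W A κ`. [folklore] -/
theorem decayBound_of_kp {EA : Functional C C.BgA} {EB : Functional C C.BgB} {W : Set (ℕ → ℝ)}
    {m : (ℕ → ℝ) → C.BgB → R.P → ℝ} {a d : R.P → ℝ} {δ : C.Dom → ℝ} {A κ : ℝ}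
    (hrep : R.Represents EA EB) (hKP : R.KPMajorant W m a d) (hdec : R.DecayExtract δ d)
    (hpin : R.PinBudget a δ A κ) : DecayBound EB W A κ := by
  obtain ⟨ha, hd, hKP'⟩ := hKP
  intro g hg U X
  obtain ⟨hm, hkp⟩ := hKP' g hg U X
  rw [hrep.2 g U X]
  have key := norm_clusterSum_le_of_kp ha hd (kpWeighted_of_majorant (fun γ hγ => (hm γ hγ).2) hkp)
    (R.pin_mem X) (R.clus_sub X) (R.clus_pin X) (hdec X)
  calc |(R.outB g U X).re| ≤ ‖R.outB g U X‖ := Complex.abs_re_le_norm _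
    _ ≤ a (R.pin X) * Real.exp (-(δ X)) := key
    _ ≤ A * Real.exp (-(κ * C.d X)) := hpin X

/-- **NE5 from an activity rate** (kernel): NE5-REP ∧ NE5-KP ∧ DECAY ∧ PIN BUDGET ∧ NE5-ACT ⇒
`T4OutputRate.NE5 EA EB W κ θ (4 c A)` — the pinned activity-Lipschitz theorem applied in the step volume of each `X`
with `ε = c θ^{scale X}`.  Every conditional of the cell ((B), (B^μ), BetaPertH-side windows) lives INSIDE the
hypotheses `W`, NE5-KP and NE5-ACT of whoever instantiates the representation; nothing about Bałaban's functionals is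
asserted here. [folklore] -/
theorem ne5_of_activityRate {EA : Functional C C.BgA} {EB : Functional C C.BgB} {W : Set (ℕ → ℝ)}
    {m : (ℕ → ℝ) → C.BgB → R.P → ℝ} {a d : R.P → ℝ} {δ : C.Dom → ℝ} {A κ θ c : ℝ}
    (hrep : R.Represents EA EB) (hKP : R.KPMajorant W m a d) (hdec : R.DecayExtract δ d)
    (hpin : R.PinBudget a δ A κ) (hθ : 0 ≤ θ) (hc : 0 ≤ c) (hact : R.ActivityRate W m θ c) :
    NE5 EA EB W κ θ (4 * c * A) := by
  obtain ⟨ha, hd, hKP'⟩ := hKP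
  intro g hg U X
  obtain ⟨hm, hkp⟩ := hKP' g hg U X
  rw [hrep.1 g U X, hrep.2 g U X, ← Complex.sub_re]
  have hε : 0 ≤ c * θ ^ C.scale X := mul_nonneg hc (pow_nonneg hθ _)
  have key := norm_clusterSum_sub_le_of_majorant ha hd hε (fun γ hγ => (hm γ hγ).1)
    (fun γ hγ => (hm γ hγ).2) (hact g hg U X) hkp (R.pin_mem X) (R.clus_sub X) (R.clus_pin X) (hdec X)
  have h4 : 0 ≤ 4 * (c * θ ^ C.scale X) := by positivity
  calc |(R.outA g U X - R.outB g U X).re| ≤ ‖R.outA g U X - R.outB g U X‖ := Complex.abs_re_le_norm _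
    _ ≤ 4 * (c * θ ^ C.scale X) * a (R.pin X) * Real.exp (-(δ X)) := key
    _ = 4 * (c * θ ^ C.scale X) * (a (R.pin X) * Real.exp (-(δ X))) := by ring
    _ ≤ 4 * (c * θ ^ C.scale X) * (A * Real.exp (-(κ * C.d X))) := mul_le_mul_of_nonneg_left (hpin X) h4
    _ = 4 * c * A * θ ^ C.scale X * Real.exp (-(κ * C.d X)) := by ring

end ClusterRep

/-! ## §5. (v2) The PENCIL form: holomorphic families of activities on a disc

The interpolation parameter of §1 is freed from the affine line: any family `z ↦ w_z` of activity families, holomorphic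
per polymer on the disc `‖z‖ < R` (`R > 1`) and satisfying the weighted Kotecký–Preiss hypothesis UNIFORMLY on the
disc, has `Σ_{C ι γ} |Φ^T(C; w_1) − Φ^T(C; w_0)| e^{d(C)} ≤ a(γ)/(R − 1)`.  This is the shape in which B13 itself uses
complex parameters — p. 7 (1.22)–(1.23): *"we extend the expression in (1.10) analytically with respect to t_□
satisfying |t_□|4B₀C₁e^{16κ₁}g_k|B| ≤ ½α₂. Taking t_□ for which the equality holds, we get 1/|t_□| =
8B₀C₁e^{16κ₁}α₂⁻¹g_k|B| < 8B₀C₁e^{16κ₁}α₂⁻¹ε₁. (1.22)"*, *"We differentiate it with respect to t_□, at t_□ = 0, and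
we represent all derivatives by the Cauchy formula"*, *"where the t_□-integration is over the circle (1.22), and the
σ(Δ)-integrations are over the circles |σ(Δ)| = e^{κ₁}"* (radius of the parameter circle = analyticity margin ÷ size of
the perturbation; gain = 1/radius) — there WITHIN one run; a pencil between the inputs of TWO runs is NOT PRINTED. -/

section Pencil

open Literature.MathematicalPhysics.QuantumFieldTheory.Dimock2015 (norm_sub_le_div_of_bound_sphere)

variable {P : Type*}

/-- **One-variable Cauchy bound on an open disc**: `f` holomorphic on `‖z‖ < R` (`R > 1`) with values in a complete
space and `‖f‖ ≤ M` there ⇒ `‖f 1 − f 0‖ ≤ M/(R − 1)` (the tree's `Dimock2015.norm_sub_le_div_of_bound_sphere` —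
Dimock's difference formula `f(1) − f(0) = (2πi)⁻¹∮_{|t|=r} f(t)dt/(t(t−1))` — on every circle `1 < r < R`, then
`r ↑ R`). [folklore] -/
theorem norm_sub_le_div_of_ball {F : Type*} [NormedAddCommGroup F] [NormedSpace ℂ F] [CompleteSpace F]
    {f : ℂ → F} {R M : ℝ} (hR : 1 < R) (hf : DifferentiableOn ℂ f (ball (0 : ℂ) R))
    (hM : ∀ z : ℂ, ‖z‖ < R → ‖f z‖ ≤ M) : ‖f 1 - f 0‖ ≤ M / (R - 1) := by
  have hM0 : 0 ≤ M := (norm_nonneg _).trans (hM 0 (by rw [norm_zero]; linarith))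
  have hr : ∀ r : ℝ, 1 < r → r < R → ‖f 1 - f 0‖ ≤ M / (r - 1) := fun r h1 h2 =>
    norm_sub_le_div_of_bound_sphere h1 (hf.mono (closedBall_subset_ball h2)) fun t ht =>
      hM t (lt_of_le_of_lt (mem_closedBall_zero_iff.1 (sphere_subset_closedBall ht)) h2)
  rw [le_div_iff₀ (by linarith : (0 : ℝ) < R - 1)]
  refine mul_le_of_forall_lt_of_nonneg (norm_nonneg _) hM0 fun D' _ hD' s hs0 hs => ?_
  rcases eq_or_lt_of_le hs0 with h | h
  · rw [← h, mul_zero]; exact hM0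
  · have key := hr (s + 1) (by linarith) (by linarith)
    rw [add_sub_cancel_right, le_div_iff₀ h] at key
    exact le_trans (mul_le_mul_of_nonneg_right hD'.le hs0) key

variable [DecidableEq P] {inc : P → P → Prop} [DecidableRel inc]

/-- **Pinned activity-Lipschitz bound — PENCIL form** (v2; v1's `touchDiffSum_le_of_kp_disc` is the affine pencil
`w_z = wB + z(wA − wB)`).  Let `inc` be reflexive and symmetric, `a, d ≥ 0`, `R > 1`, and let `z ↦ w_z` be a family of
activity families, holomorphic on the disc `‖z‖ < R` polymer by polymer on the finite volume `L`, such that the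
`d`-weighted Kotecký–Preiss hypothesis [KP86, (S)] with size function `a` holds in `L` for EVERY `w_z`, `‖z‖ < R`.
Then for `γ ∈ L`:  `Σ_{C ⊆ L, C ι γ} |Φ^T(C; w_1) − Φ^T(C; w_0)| e^{d(C)} ≤ a(γ)/(R − 1)`.
Proof (kernel): the scalarised generating function `G(z) = Σ_C e^{d(C)} u_C Φ^T(C; w_z)` (`u_C` the unit co-phases
of the differences) is holomorphic on the disc (zero-freeness of all rays by [KP86] Theorem, tree
`polymerPartitionFunction_ne_zero_of_kp`; `differentiableOn_polymerLogZ_param`) and bounded there by `a(γ)` ([KP86, (4)],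
tree `touchSum_le_of_kp`); `norm_sub_le_div_of_ball`.  No doubling of a majorant and no factor 4: the pencil is
required to stay in the KP region itself. [folklore] -/
theorem touchDiffSum_le_of_kp_disc_family [Std.Refl inc] [Std.Symm inc] {w : ℂ → P → ℂ} {a d : P → ℝ}
    (ha : ∀ γ, 0 ≤ a γ) (hd : ∀ γ, 0 ≤ d γ) {L : Finset P} {R : ℝ} (hR : 1 < R)
    (hw : ∀ γ' ∈ L, DifferentiableOn ℂ (fun z => w z γ') (ball (0 : ℂ) R))
    (hKP : ∀ z : ℂ, ‖z‖ < R → ∀ γ ∈ L,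
      ∑ γ' ∈ L with inc γ' γ, ‖w z γ'‖ * Real.exp (a γ' + d γ') ≤ a γ)
    {γ : P} (hγ : γ ∈ L) :
    touchDiffSum inc (w 1) (w 0) d L γ ≤ a γ / (R - 1) := by
  -- the scalarised generating function
  obtain ⟨G, hGdef⟩ : ∃ G : ℂ → ℂ, G = fun z => ∑ C ∈ L.powerset with KPTouches inc C γ,
      (Real.exp (∑ γ' ∈ C, d γ') : ℂ) * phaseOf (truncatedWeight inc (w 1) C - truncatedWeight inc (w 0) C) *
        truncatedWeight inc (w z) C := ⟨_, rfl⟩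
  -- (1) zero-freeness of all rays of all sub-volumes along the disc (KP, [KP86, Theorem])
  have hZ : ∀ z ∈ ball (0 : ℂ) R, ∀ B : Finset P, B ⊆ L → ∀ t ∈ Set.Icc (0 : ℝ) 1,
      polymerPartitionFunction inc (fun γ' => (t : ℂ) * w z γ') B ≠ 0 := by
    intro z hz B hB t ht
    have hKPz : IsKPVolume inc (w z) a L := isKPVolume_of_kpd hd (hKP z (mem_ball_zero_iff.1 hz))
    have hKPt : IsKPVolume inc (fun γ' => (t : ℂ) * w z γ') a L := by
      intro γ₀ hγ₀
      refine le_trans (Finset.sum_le_sum fun γ' _ => ?_) (hKPz γ₀ hγ₀)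
      unfold kpTerm
      refine mul_le_mul_of_nonneg_right ?_ (Real.exp_nonneg _)
      rw [norm_mul, Complex.norm_real, Real.norm_eq_abs, abs_of_nonneg ht.1]
      exact mul_le_of_le_one_left (norm_nonneg _) ht.2
    exact polymerPartitionFunction_ne_zero_of_kp hKPt hB
  -- (2) `G` is holomorphic on the disc
  have hGdiff : DifferentiableOn ℂ G (ball (0 : ℂ) R) := by
    rw [hGdef]
    refine DifferentiableOn.fun_sum fun C hC => ?_
    have hCL : C ⊆ L := Finset.mem_powerset.1 (Finset.mem_filter.1 hC).1
    refine DifferentiableOn.const_mul ?_ _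
    show DifferentiableOn ℂ (fun z => truncatedWeight inc (w z) C) (ball 0 R)
    unfold truncatedWeight
    refine DifferentiableOn.fun_sum fun B hB => ?_
    have hBL : B ⊆ L := (Finset.mem_powerset.1 hB).trans hCL
    refine DifferentiableOn.const_mul ?_ _
    exact differentiableOn_polymerLogZ_param (v := w) B isOpen_ball
      (fun γ' hγ' => hw γ' (hBL hγ')) (fun z hz t ht => hZ z hz B hBL t ht)
  -- (3) `|G z| ≤ a γ` on the disc (KP estimate (4) at each `w_z`)
  have hGle : ∀ z : ℂ, ‖z‖ < R → ‖G z‖ ≤ a γ := by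
    intro z hz
    rw [hGdef]
    calc ‖∑ C ∈ L.powerset with KPTouches inc C γ,
            (Real.exp (∑ γ' ∈ C, d γ') : ℂ) * phaseOf (truncatedWeight inc (w 1) C - truncatedWeight inc (w 0) C) *
              truncatedWeight inc (w z) C‖
        ≤ ∑ C ∈ L.powerset with KPTouches inc C γ,
            ‖(Real.exp (∑ γ' ∈ C, d γ') : ℂ) * phaseOf (truncatedWeight inc (w 1) C - truncatedWeight inc (w 0) C) *
              truncatedWeight inc (w z) C‖ := norm_sum_le _ _
      _ ≤ ∑ C ∈ L.powerset with KPTouches inc C γ,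
            ‖truncatedWeight inc (w z) C‖ * Real.exp (∑ γ' ∈ C, d γ') := by
          refine Finset.sum_le_sum fun C _ => ?_
          rw [norm_mul, norm_mul, Complex.norm_real, Real.norm_of_nonneg (Real.exp_nonneg _)]
          have h1 := norm_phaseOf_le_one (truncatedWeight inc (w 1) C - truncatedWeight inc (w 0) C)
          have he := Real.exp_nonneg (∑ γ' ∈ C, d γ')
          have hn := norm_nonneg (truncatedWeight inc (w z) C)
          nlinarith [mul_nonneg he hn]
      _ = touchSum inc (w z) d L γ := rfl
      _ ≤ a γ := touchSum_le_of_kp ha hd (hKP z hz) hγ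
  -- (4) `G 1 - G 0` is the (real) pinned difference sum; the one-variable Cauchy bound
  have hG10 : G 1 - G 0 = ((touchDiffSum inc (w 1) (w 0) d L γ : ℝ) : ℂ) := by
    rw [hGdef]
    beta_reduce
    rw [← Finset.sum_sub_distrib, touchDiffSum, Complex.ofReal_sum]
    refine Finset.sum_congr rfl fun C _ => ?_
    rw [← mul_sub, mul_assoc, phaseOf_mul_self, Complex.ofReal_mul, mul_comm]
  have h := norm_sub_le_div_of_ball hR hGdiff hGle
  rw [hG10, Complex.norm_real, Real.norm_of_nonneg (touchDiffSum_nonneg _ _ d L γ)] at h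
  exact h

/-- Localization of a pinned difference sum (the mechanism of (2.39)–(2.41)): if every `C ∈ 𝒞` lies in `L`, touches
the pin `γ`, and carries weight `Σ_{γ'∈C} d(γ') ≥ δ`, then `Σ_{C∈𝒞} |Φ^T(C; wA) − Φ^T(C; wB)|` is at most the pinned
`d`-weighted difference sum times `e^{−δ}`. [folklore] -/
theorem sum_norm_truncatedWeight_sub_le_touchDiffSum {wA wB : P → ℂ} (d : P → ℝ) {L : Finset P}
    {𝒞 : Finset (Finset P)} {γ : P} (hsub : ∀ C ∈ 𝒞, C ⊆ L) (hpin : ∀ C ∈ 𝒞, KPTouches inc C γ)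
    {δ : ℝ} (hdec : ∀ C ∈ 𝒞, δ ≤ ∑ γ' ∈ C, d γ') :
    ∑ C ∈ 𝒞, ‖truncatedWeight inc wA C - truncatedWeight inc wB C‖ ≤
      touchDiffSum inc wA wB d L γ * Real.exp (-δ) := by
  have h𝒞 : 𝒞 ⊆ L.powerset.filter (fun C => KPTouches inc C γ) := fun C hC =>
    Finset.mem_filter.2 ⟨Finset.mem_powerset.2 (hsub C hC), hpin C hC⟩
  calc ∑ C ∈ 𝒞, ‖truncatedWeight inc wA C - truncatedWeight inc wB C‖
      ≤ ∑ C ∈ 𝒞, ‖truncatedWeight inc wA C - truncatedWeight inc wB C‖ * Real.exp (∑ γ' ∈ C, d γ') *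
          Real.exp (-δ) := by
        refine Finset.sum_le_sum fun C hC => ?_
        rw [mul_assoc, ← Real.exp_add]
        have h1 : (1 : ℝ) ≤ Real.exp (∑ γ' ∈ C, d γ' + -δ) := Real.one_le_exp (by linarith [hdec C hC])
        nlinarith [norm_nonneg (truncatedWeight inc wA C - truncatedWeight inc wB C)]
    _ = (∑ C ∈ 𝒞, ‖truncatedWeight inc wA C - truncatedWeight inc wB C‖ * Real.exp (∑ γ' ∈ C, d γ')) *
          Real.exp (-δ) := by rw [Finset.sum_mul]
    _ ≤ touchDiffSum inc wA wB d L γ * Real.exp (-δ) := by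
        refine mul_le_mul_of_nonneg_right ?_ (Real.exp_nonneg _)
        unfold touchDiffSum
        exact Finset.sum_le_sum_of_subset_of_nonneg h𝒞 fun C _ _ =>
          mul_nonneg (norm_nonneg _) (Real.exp_nonneg _)

/-- **Pinned Lipschitz bound, sum of norms — pencil form**: under the hypotheses of
`touchDiffSum_le_of_kp_disc_family` and the pin/decay hypotheses of §2,
`Σ_{C ∈ 𝒞} |Φ^T(C; w_1) − Φ^T(C; w_0)| ≤ a(γ) e^{−δ}/(R − 1)`. [folklore] -/
theorem sum_norm_truncatedWeight_sub_le_of_family [Std.Refl inc] [Std.Symm inc] {w : ℂ → P → ℂ}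
    {a d : P → ℝ} (ha : ∀ γ, 0 ≤ a γ) (hd : ∀ γ, 0 ≤ d γ) {L : Finset P} {R : ℝ} (hR : 1 < R)
    (hw : ∀ γ' ∈ L, DifferentiableOn ℂ (fun z => w z γ') (ball (0 : ℂ) R))
    (hKP : ∀ z : ℂ, ‖z‖ < R → ∀ γ ∈ L,
      ∑ γ' ∈ L with inc γ' γ, ‖w z γ'‖ * Real.exp (a γ' + d γ') ≤ a γ)
    {𝒞 : Finset (Finset P)} {γ : P} (hγ : γ ∈ L) (hsub : ∀ C ∈ 𝒞, C ⊆ L)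
    (hpin : ∀ C ∈ 𝒞, KPTouches inc C γ) {δ : ℝ} (hdec : ∀ C ∈ 𝒞, δ ≤ ∑ γ' ∈ C, d γ') :
    ∑ C ∈ 𝒞, ‖truncatedWeight inc (w 1) C - truncatedWeight inc (w 0) C‖ ≤
      a γ / (R - 1) * Real.exp (-δ) :=
  (sum_norm_truncatedWeight_sub_le_touchDiffSum d hsub hpin hdec).trans
    (mul_le_mul_of_nonneg_right (touchDiffSum_le_of_kp_disc_family ha hd hR hw hKP hγ) (Real.exp_nonneg _))

/-- **Pinned Lipschitz bound for localized cluster sums — pencil form**: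
`|E_{w_1}(𝒞) − E_{w_0}(𝒞)| ≤ a(γ) e^{−δ}/(R − 1)`. [folklore] -/
theorem norm_clusterSum_sub_le_of_family [Std.Refl inc] [Std.Symm inc] {w : ℂ → P → ℂ} {a d : P → ℝ}
    (ha : ∀ γ, 0 ≤ a γ) (hd : ∀ γ, 0 ≤ d γ) {L : Finset P} {R : ℝ} (hR : 1 < R)
    (hw : ∀ γ' ∈ L, DifferentiableOn ℂ (fun z => w z γ') (ball (0 : ℂ) R))
    (hKP : ∀ z : ℂ, ‖z‖ < R → ∀ γ ∈ L,
      ∑ γ' ∈ L with inc γ' γ, ‖w z γ'‖ * Real.exp (a γ' + d γ') ≤ a γ)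
    {𝒞 : Finset (Finset P)} {γ : P} (hγ : γ ∈ L) (hsub : ∀ C ∈ 𝒞, C ⊆ L)
    (hpin : ∀ C ∈ 𝒞, KPTouches inc C γ) {δ : ℝ} (hdec : ∀ C ∈ 𝒞, δ ≤ ∑ γ' ∈ C, d γ') :
    ‖clusterSum inc (w 1) 𝒞 - clusterSum inc (w 0) 𝒞‖ ≤ a γ / (R - 1) * Real.exp (-δ) := by
  unfold clusterSum
  rw [← Finset.sum_sub_distrib]
  exact (norm_sum_le _ _).trans (sum_norm_truncatedWeight_sub_le_of_family ha hd hR hw hKP hγ hsub hpin hdec)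

end Pencil

/-! ## §6. (v2) The printed letters, pencil form: (2.39)–(2.41) for a pencil of activity families

Under EXACTLY the hypotheses of the one-run kernel `B13Resummation.norm_locE_le` / `norm_locE_le_of_small` (nothing
halved, KP for the (2.38)-majorant itself) holding uniformly along a pencil of radius `Rz > 1`, the X-localized outputs
(2.13) at the two ends differ by at most the (2.41) kernel envelope divided by `Rz − 1`.  The anchored assembly is
factored out as `sum_coveringFamilies_le_of_anchored` (a statement about any nonnegative cluster functional; §4's v1
proof inlines the same steps). -/

section PrintedLettersPencil

open Literature.MathematicalPhysics.QuantumFieldTheory.Balaban1983to89.B13FamilySum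
  (coveringFamilies mem_coveringFamilies Ineq126 VolBound Ineq227)
open Literature.MathematicalPhysics.QuantumFieldTheory.Balaban1983to89.B13Resummation (locE locE_congr kp_condition)

variable {Dom Cube : Type*} [DecidableEq Dom] [DecidableEq Cube] [Fintype Dom]

/-- **The anchored assembly of (2.39)–(2.41) as a lemma.**  If a nonnegative functional `f` of the families `C` with
`∪_{Z∈C} Z = X` satisfies, for every anchoring polymer `Z`, `Σ_{C ∋ Z} f(C) ≤ Λ · τ#cubes(Z) · e^{−((r₁d_X + b) +
(κ₀+1)d(Z))}`, then (anchor cube `q₀ ∈ X`, volume bound (2.30) `#cubes(Z) ≤ c₁(1 + d(Z)) ≤ c₁e^{d(Z)}`, (1.26) over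
the polymers containing `q₀`) `Σ_C f(C) ≤ Λ · τc₁K₀e^{−b} · e^{−r₁d_X}`.  Printed locus (pp. 20–21): *"The series
(2.13), defining E^{(k+1)}(X), is estimated in the standard way, each factor |H(Z)| is replaced by the right-hand side
of (2.38) in the bound. Consider a term in the sum. We have a product of n exponentials from (2.38). We extract the
exponential exp(−δ½Lκd_{k+1}(Z_i)) from the i-th factor, and the remaining product is estimated using (2.27), and the
condition ∪Z_i = X, X is a connected domain"* — this yields (2.39) — and (p. 21) *"To the above sum we can repeat all
the considerations and bounds of the paper [26], for κ sufficiently large, and ε₁ sufficiently small"*, giving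
(2.40)–(2.41).  The ANCHORING device of this lemma (fix a cube `q₀ ∈ X`, sum over the polymers containing it with
(1.26), volume bound (2.30)) is this file's own [folklore] rendering of «the considerations and bounds of the paper
[26]», stated in our words — it is NOT a quotation (cf. the analogous printed step on p. 19: *"A sum over n components
is estimated by a product of n sums, each of them is a sum over independently changing components. The last sum is
estimated using (1.28)"*).  v3.1 DOCFIX (cell GAPS C-pv03-54, D1): v2–v3 printed at this place a composite italic
quotation attributed to p. 21 whose first two fragments («we fix points y_i ∈ Z_i …», «… estimate each sum as in
(1.28)») are not in B13 (pp. 8, 13–22 read by the cross-reader) — withdrawn; the third fragment was and is verbatim.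
[cite: Balaban1988RG2Cluster, (2.39)-(2.41) pp.20-21] -/
theorem sum_coveringFamilies_le_of_anchored {cubes : Dom → Finset Cube} {d : Dom → ℝ} (f : Finset Dom → ℝ)
    {Λ τ r₁ κ₀ K₀ c₁ b dX : ℝ} {X : Finset Cube}
    (hf : ∀ C, 0 ≤ f C) (hΛ : 0 ≤ Λ) (hτ : 0 ≤ τ) (hc₁ : 0 ≤ c₁)
    (h126 : Ineq126 (Finset.univ : Finset Dom) cubes d κ₀ K₀)
    (hvol : VolBound (Finset.univ : Finset Dom) cubes d c₁)
    (hanchor : ∀ Z, ∑ C ∈ (coveringFamilies (Finset.univ : Finset Dom) cubes X) with Z ∈ C, f C ≤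
      Λ * (τ * ((cubes Z).card : ℝ)) * Real.exp (-((r₁ * dX + b) + (κ₀ + 1) * d Z)))
    (hX : X.Nonempty) :
    ∑ C ∈ coveringFamilies (Finset.univ : Finset Dom) cubes X, f C ≤
      Λ * (τ * c₁ * K₀ * Real.exp (-b) * Real.exp (-(r₁ * dX))) := by
  obtain ⟨q₀, hq₀⟩ := hX
  set 𝒞 : Finset (Finset Dom) := coveringFamilies (Finset.univ : Finset Dom) cubes X with h𝒞
  have hcover : 𝒞 ⊆ (Finset.univ.filter fun Z => q₀ ∈ cubes Z).biUnion
      (fun Z => 𝒞.filter fun C => Z ∈ C) := by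
    intro C hC
    have hU : C.biUnion cubes = X := (mem_coveringFamilies.1 hC).2
    have hq : q₀ ∈ C.biUnion cubes := by rw [hU]; exact hq₀
    obtain ⟨Z, hZC, hqZ⟩ := Finset.mem_biUnion.1 hq
    exact Finset.mem_biUnion.2 ⟨Z, Finset.mem_filter.2 ⟨Finset.mem_univ _, hqZ⟩,
      Finset.mem_filter.2 ⟨hC, hZC⟩⟩
  -- per anchoring polymer: `e^{-(P + (κ₀+1)d)} τ #cubes ≤ e^{-P} τ c₁ e^{-κ₀ d}`
  have hper : ∀ Z, Λ * (τ * ((cubes Z).card : ℝ)) * Real.exp (-((r₁ * dX + b) + (κ₀ + 1) * d Z)) ≤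
      Λ * (Real.exp (-(r₁ * dX + b)) * (τ * c₁) * Real.exp (-(κ₀ * d Z))) := by
    intro Z
    have hv : τ * ((cubes Z).card : ℝ) ≤ τ * c₁ * Real.exp (d Z) := by
      have h1' : ((cubes Z).card : ℝ) ≤ c₁ * (1 + d Z) := hvol Z (Finset.mem_univ _)
      have h2' : c₁ * (1 + d Z) ≤ c₁ * Real.exp (d Z) :=
        mul_le_mul_of_nonneg_left (by linarith [Real.add_one_le_exp (d Z)]) hc₁
      calc τ * ((cubes Z).card : ℝ) ≤ τ * (c₁ * Real.exp (d Z)) :=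
            mul_le_mul_of_nonneg_left (h1'.trans h2') hτ
        _ = τ * c₁ * Real.exp (d Z) := by ring
    have hsplit : Real.exp (-((r₁ * dX + b) + (κ₀ + 1) * d Z)) * Real.exp (d Z) =
        Real.exp (-(r₁ * dX + b)) * Real.exp (-(κ₀ * d Z)) := by
      rw [← Real.exp_add, ← Real.exp_add]
      congr 1
      ring
    rw [mul_assoc Λ]
    refine mul_le_mul_of_nonneg_left ?_ hΛ
    calc τ * ((cubes Z).card : ℝ) * Real.exp (-((r₁ * dX + b) + (κ₀ + 1) * d Z))
        ≤ (τ * c₁ * Real.exp (d Z)) * Real.exp (-((r₁ * dX + b) + (κ₀ + 1) * d Z)) :=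
          mul_le_mul_of_nonneg_right hv (Real.exp_nonneg _)
      _ = (τ * c₁) * (Real.exp (-((r₁ * dX + b) + (κ₀ + 1) * d Z)) * Real.exp (d Z)) := by ring
      _ = Real.exp (-(r₁ * dX + b)) * (τ * c₁) * Real.exp (-(κ₀ * d Z)) := by rw [hsplit]; ring
  -- assembly
  calc ∑ C ∈ 𝒞, f C
      ≤ ∑ C ∈ (Finset.univ.filter fun Z => q₀ ∈ cubes Z).biUnion (fun Z => 𝒞.filter fun C => Z ∈ C), f C :=
        Finset.sum_le_sum_of_subset_of_nonneg hcover fun C _ _ => hf C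
    _ ≤ ∑ Z ∈ Finset.univ.filter (fun Z => q₀ ∈ cubes Z), ∑ C ∈ 𝒞.filter (fun C => Z ∈ C), f C :=
        sum_biUnion_le_sum_of_nonneg _ _ _ hf
    _ ≤ ∑ Z ∈ Finset.univ.filter (fun Z => q₀ ∈ cubes Z),
          Λ * (τ * ((cubes Z).card : ℝ)) * Real.exp (-((r₁ * dX + b) + (κ₀ + 1) * d Z)) :=
        Finset.sum_le_sum fun Z _ => hanchor Z
    _ ≤ ∑ Z ∈ Finset.univ.filter (fun Z => q₀ ∈ cubes Z),
          Λ * (Real.exp (-(r₁ * dX + b)) * (τ * c₁) * Real.exp (-(κ₀ * d Z))) :=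
        Finset.sum_le_sum fun Z _ => hper Z
    _ = Λ * (Real.exp (-(r₁ * dX + b)) * (τ * c₁)) *
          ∑ Z ∈ Finset.univ.filter (fun Z => q₀ ∈ cubes Z), Real.exp (-(κ₀ * d Z)) := by
        rw [Finset.mul_sum]
        exact Finset.sum_congr rfl fun Z _ => by ring
    _ ≤ Λ * (Real.exp (-(r₁ * dX + b)) * (τ * c₁)) * K₀ :=
        mul_le_mul_of_nonneg_left (h126 q₀) (by positivity)
    _ = Λ * (τ * c₁ * K₀ * Real.exp (-b) * Real.exp (-(r₁ * dX))) := by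
        rw [neg_add, Real.exp_add]; ring

omit [DecidableEq Dom] in
/-- **(2.27)-extraction for an anchored member** (the step *"the remaining product is estimated using (2.27)"*, p. 21):
for a covering family `K` of `X` (tree-length `d_X`, (2.27)-constant `c`) containing `Z`, with per-member cost `b ≥ r₁c`,
`(r₁d_X + b) + (κ₀+1)d(Z) ≤ Σ_{Z'∈K} ((r₁ + κ₀ + 1)d(Z') + b)`.  B13 p. 18: *"Σ_{Y∈𝐃} (d_k(Y) + 5) ≥ d_k(Y₀) + 5.
(2.27)"* (tree `B13FamilySum.Ineq227`). [cite: Balaban1988RG2Cluster, (2.27) p.18] -/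
theorem anchoredDecay_le_sum {cubes : Dom → Finset Cube} {d : Dom → ℝ} {r₁ κ₀ c b dX : ℝ} {X : Finset Cube}
    (hd : ∀ Z, 0 ≤ d Z) (hκ₀ : 0 ≤ κ₀) (hr₁ : 0 ≤ r₁) (hb : r₁ * c ≤ b)
    (h227 : Ineq227 (Finset.univ : Finset Dom) cubes d X dX c) {K : Finset Dom} {Z : Dom}
    (hK : K ∈ coveringFamilies (Finset.univ : Finset Dom) cubes X) (hZK : Z ∈ K) :
    (r₁ * dX + b) + (κ₀ + 1) * d Z ≤ ∑ Z' ∈ K, ((r₁ + (κ₀ + 1)) * d Z' + b) := by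
  have h227C : dX + c ≤ ∑ Z' ∈ K, (d Z' + c) := h227 K hK
  rw [Finset.sum_add_distrib, Finset.sum_const, nsmul_eq_mul] at h227C
  rw [Finset.sum_add_distrib, Finset.sum_const, nsmul_eq_mul, ← Finset.mul_sum]
  have hcard : (1 : ℝ) ≤ (K.card : ℝ) := by exact_mod_cast Finset.card_pos.2 ⟨Z, hZK⟩
  have hsingle : d Z ≤ ∑ Z' ∈ K, d Z' := Finset.single_le_sum (fun Z' _ => hd Z') hZK
  have hkey : (r₁ + (κ₀ + 1)) * (∑ Z' ∈ K, d Z') + (K.card : ℝ) * b -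
      ((r₁ * dX + b) + (κ₀ + 1) * d Z) =
      r₁ * ((∑ Z' ∈ K, d Z') + (K.card : ℝ) * c - (dX + c)) + (κ₀ + 1) * ((∑ Z' ∈ K, d Z') - d Z) +
        ((K.card : ℝ) - 1) * (b - r₁ * c) := by ring
  have t₁ : 0 ≤ r₁ * ((∑ Z' ∈ K, d Z') + (K.card : ℝ) * c - (dX + c)) :=
    mul_nonneg hr₁ (sub_nonneg.2 h227C)
  have t₂ : 0 ≤ (κ₀ + 1) * ((∑ Z' ∈ K, d Z') - d Z) := mul_nonneg (by linarith) (sub_nonneg.2 hsingle)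
  have t₃ : 0 ≤ ((K.card : ℝ) - 1) * (b - r₁ * c) := mul_nonneg (sub_nonneg.2 hcard) (sub_nonneg.2 hb)
  linarith

variable (ι : Dom → Dom → Prop) [DecidableRel ι]

/-- **(2.39)–(2.41), PENCIL form in the printed letters** (v2 companion of `norm_locE_sub_locE_le` and of the one-run
kernel `B13Resummation.norm_locE_le`).  Same geometric hypotheses as `norm_locE_le` ((1.26) `κ₀, K₀`, volume bound
`c₁`, footprint-local incompatibility `reach, ν`, (2.27) with constant `c` for the covering families of `X`, cost
`b ≥ r₁c`, rate `r₁ + 2κ₀ + 1 + τc₁ ≤ R`, smallness `A e^{b+τc₁} K₀ ν ≤ τ` — NOTHING halved or doubled); a PENCIL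
`z ↦ w_z` of activity families, holomorphic on `‖z‖ < Rz` (`Rz > 1`) for each polymer `Z ⊂ X` and bounded there by
the (2.38)-majorant `A e^{−R d(Z)}`.  Then `|E^{(k+1)}_{w_1}(X) − E^{(k+1)}_{w_0}(X)| ≤ (τ c₁ K₀ e^{−b} e^{−r₁ d(X)})
/(Rz − 1)` — the envelope of `norm_locE_le` divided by `Rz − 1`.  Printed TYPE of the mechanism: B13 differentiates
in complex parameters entering its operators and pays 1/radius, (1.22)–(1.23) p. 7, and treats (2.14) p. 15 *"as an
analytic function of (𝐔, 𝐉) in the space 𝐔^c_{k+1}(X, α₀, α₁), and of the complex parameters σ(Z), τ"* with the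
τ-radius (2.18) p. 16 — all WITHIN one run; the pencil between the inputs of two runs (lattice spacings η, η/L) that an
instantiation for the cell's NE5 needs is NOT PRINTED. [cite: Balaban1988RG2Cluster, (2.39)-(2.41) p.21; (1.22)-(1.23) p.7] -/
theorem norm_locE_sub_locE_le_of_pencil [Std.Refl ι] [Std.Symm ι] {cubes reach : Dom → Finset Cube}
    {d : Dom → ℝ} {w : ℂ → Dom → ℂ} {A R r₁ κ₀ K₀ c₁ c b τ ν dX Rz : ℝ} {X : Finset Cube}
    (hloc : ∀ Z Z', ι Z' Z → ∃ q ∈ reach Z, q ∈ cubes Z')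
    (hreach : ∀ Z, ((reach Z).card : ℝ) ≤ ν * (cubes Z).card)
    (hd : ∀ Z, 0 ≤ d Z) (hA : 0 ≤ A) (hK₀ : 0 ≤ K₀) (hc₁ : 0 ≤ c₁) (hτ : 0 ≤ τ) (hκ₀ : 0 ≤ κ₀)
    (hr₁ : 0 ≤ r₁) (hc : 0 ≤ c) (hb : r₁ * c ≤ b) (hRz : 1 < Rz)
    (hhol : ∀ Z, cubes Z ⊆ X → DifferentiableOn ℂ (fun z => w z Z) (ball (0 : ℂ) Rz))
    (hw : ∀ z : ℂ, ‖z‖ < Rz → ∀ Z, cubes Z ⊆ X → ‖w z Z‖ ≤ A * Real.exp (-(R * d Z)))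
    (h126 : Ineq126 (Finset.univ : Finset Dom) cubes d κ₀ K₀)
    (hvol : VolBound (Finset.univ : Finset Dom) cubes d c₁)
    (h227 : Ineq227 (Finset.univ : Finset Dom) cubes d X dX c)
    (hrate : r₁ + 2 * κ₀ + 1 + τ * c₁ ≤ R) (hsmall : A * Real.exp (b + τ * c₁) * K₀ * ν ≤ τ)
    (hX : X.Nonempty) :
    ‖locE ι cubes (w 1) X - locE ι cubes (w 0) X‖ ≤
      (τ * c₁ * K₀ * Real.exp (-b) * Real.exp (-(r₁ * dX))) / (Rz - 1) := by
  -- the majorant and the pencil truncated to the polymers inside `X`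
  set m : Dom → ℝ := fun Z => A * Real.exp (-(R * d Z)) with hm_def
  have hm0 : ∀ Z, 0 ≤ m Z := fun Z => mul_nonneg hA (Real.exp_nonneg _)
  set w' : ℂ → Dom → ℂ := fun z Z => if cubes Z ⊆ X then w z Z else 0 with hw'_def
  have hw'm : ∀ z : ℂ, ‖z‖ < Rz → ∀ Z, ‖w' z Z‖ ≤ m Z := by
    intro z hz Z
    by_cases h : cubes Z ⊆ X
    · simp only [hw'_def, h, if_true]; exact hw z hz Z h
    · simp only [hw'_def, h, if_false, norm_zero]; exact hm0 Z
  have hhol' : ∀ Z ∈ (Finset.univ : Finset Dom), DifferentiableOn ℂ (fun z => w' z Z) (ball (0 : ℂ) Rz) := by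
    intro Z _
    by_cases h : cubes Z ⊆ X
    · simp only [hw'_def, h, if_true]; exact hhol Z h
    · simp only [hw'_def, h, if_false]; exact differentiableOn_const 0
  rw [locE_congr ι (w := w 1) (w' := w' 1) (fun Z hZ => by simp only [hw'_def, hZ, if_true]),
    locE_congr ι (w := w 0) (w' := w' 0) (fun Z hZ => by simp only [hw'_def, hZ, if_true])]
  -- Kotecký–Preiss data `a(Z) = τ #cubes Z`, `d(Z) ↦ (r₁ + (κ₀ + 1)) d(Z) + b`, for the majorant itself
  have hb0 : 0 ≤ b := le_trans (mul_nonneg hr₁ hc) hb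
  have ha : ∀ Z, 0 ≤ τ * ((cubes Z).card : ℝ) := fun Z => mul_nonneg hτ (Nat.cast_nonneg _)
  have hdK : ∀ Z, 0 ≤ (r₁ + (κ₀ + 1)) * d Z + b := fun Z =>
    add_nonneg (mul_nonneg (by linarith) (hd Z)) hb0
  have hmC : ∀ Z, ‖((m Z : ℝ) : ℂ)‖ ≤ A * Real.exp (-(R * d Z)) := fun Z => by
    rw [Complex.norm_real, Real.norm_of_nonneg (hm0 Z)]
  have hkp := kp_condition ι hloc hreach hd hA hK₀ hτ (w := fun Z => ((m Z : ℝ) : ℂ)) hmC h126 hvol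
    (s := r₁ + (κ₀ + 1)) (b := b) (by linarith) hsmall
  have hKPz : ∀ z : ℂ, ‖z‖ < Rz → ∀ Z ∈ (Finset.univ : Finset Dom), ∑ Z' ∈ Finset.univ with ι Z' Z,
      ‖w' z Z'‖ * Real.exp (τ * ((cubes Z').card : ℝ) + ((r₁ + (κ₀ + 1)) * d Z' + b)) ≤
        τ * ((cubes Z).card : ℝ) := by
    intro z hz Z _
    refine le_trans (Finset.sum_le_sum fun Z' _ => ?_) (hkp Z)
    refine mul_le_mul_of_nonneg_right ?_ (Real.exp_nonneg _)
    rw [Complex.norm_real, Real.norm_of_nonneg (hm0 Z')]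
    exact hw'm z hz Z'
  -- the pinned pencil bound at each anchoring polymer, with the (2.27)-extraction of the union's decay
  have hanchor : ∀ Z, ∑ C ∈ (coveringFamilies (Finset.univ : Finset Dom) cubes X) with Z ∈ C,
      ‖truncatedWeight ι (w' 1) C - truncatedWeight ι (w' 0) C‖ ≤
      (Rz - 1)⁻¹ * (τ * ((cubes Z).card : ℝ)) * Real.exp (-((r₁ * dX + b) + (κ₀ + 1) * d Z)) := by
    intro Z
    have h := sum_norm_truncatedWeight_sub_le_of_family (inc := ι) (a := fun Z => τ * ((cubes Z).card : ℝ))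
      (d := fun Z => (r₁ + (κ₀ + 1)) * d Z + b) ha hdK hRz hhol' hKPz (Finset.mem_univ Z)
      (𝒞 := (coveringFamilies (Finset.univ : Finset Dom) cubes X).filter fun C => Z ∈ C)
      (fun C _ => Finset.subset_univ C) (fun C hC => ⟨Z, (Finset.mem_filter.1 hC).2, refl Z⟩)
      (δ := (r₁ * dX + b) + (κ₀ + 1) * d Z)
      (fun C hC => anchoredDecay_le_sum hd hκ₀ hr₁ hb h227 (Finset.mem_filter.1 hC).1 (Finset.mem_filter.1 hC).2)
    calc ∑ C ∈ (coveringFamilies (Finset.univ : Finset Dom) cubes X) with Z ∈ C,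
          ‖truncatedWeight ι (w' 1) C - truncatedWeight ι (w' 0) C‖
        ≤ τ * ((cubes Z).card : ℝ) / (Rz - 1) * Real.exp (-((r₁ * dX + b) + (κ₀ + 1) * d Z)) := h
      _ = (Rz - 1)⁻¹ * (τ * ((cubes Z).card : ℝ)) * Real.exp (-((r₁ * dX + b) + (κ₀ + 1) * d Z)) := by ring
  -- the anchored assembly
  have hnn : ∀ C : Finset Dom, 0 ≤ ‖truncatedWeight ι (w' 1) C - truncatedWeight ι (w' 0) C‖ :=
    fun C => norm_nonneg _
  have hΛ : 0 ≤ (Rz - 1)⁻¹ := inv_nonneg.2 (by linarith)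
  have hsum := sum_coveringFamilies_le_of_anchored
    (fun C => ‖truncatedWeight ι (w' 1) C - truncatedWeight ι (w' 0) C‖) hnn hΛ hτ hc₁ h126 hvol hanchor hX
  calc ‖locE ι cubes (w' 1) X - locE ι cubes (w' 0) X‖
      = ‖∑ C ∈ coveringFamilies (Finset.univ : Finset Dom) cubes X,
          (truncatedWeight ι (w' 1) C - truncatedWeight ι (w' 0) C)‖ := by
        rw [Finset.sum_sub_distrib]; rfl
    _ ≤ ∑ C ∈ coveringFamilies (Finset.univ : Finset Dom) cubes X,
          ‖truncatedWeight ι (w' 1) C - truncatedWeight ι (w' 0) C‖ := norm_sum_le _ _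
    _ ≤ (Rz - 1)⁻¹ * (τ * c₁ * K₀ * Real.exp (-b) * Real.exp (-(r₁ * dX))) := hsum
    _ = (τ * c₁ * K₀ * Real.exp (-b) * Real.exp (-(r₁ * dX))) / (Rz - 1) := by
        rw [div_eq_inv_mul]

/-- **(2.41), PENCIL kernel form** (v2 companion of `norm_locE_sub_locE_le_of_small` and of
`B13Resummation.norm_locE_le_of_small`).  With τ = A e^{b+1} K₀ ν: if **A e^{b+1} K₀ ν c₁ ≤ 1** and **r₁ + 2κ₀ + 2 ≤ R**
— EXACTLY the one-run conditions ("ε₁ sufficiently small", "κ sufficiently large", p. 21), nothing halved — then for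
every nonempty union `X` with (2.27) for its covering families and every pencil as in `norm_locE_sub_locE_le_of_pencil`:
`|E^{(k+1)}_{w_1}(X) − E^{(k+1)}_{w_0}(X)| ≤ (e ν c₁ K₀²) · A · e^{−r₁ d(X)} / (Rz − 1)` — the (2.41) envelope
*"O(1)C₃ε₁ exp(−(1 − 10δ)½Lκd_{k+1}(X))"* (A = C₃ε₁, r₁ = (1 − 10δ)½Lκ) divided by `Rz − 1`, where `Rz` is the radius up
to which the pencil of activity families stays under the (2.38)-majorant. [cite: Balaban1988RG2Cluster, (2.41) p.21] -/
theorem norm_locE_sub_locE_le_of_pencil_small [Std.Refl ι] [Std.Symm ι] {cubes reach : Dom → Finset Cube}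
    {d : Dom → ℝ} {w : ℂ → Dom → ℂ} {A R r₁ κ₀ K₀ c₁ c b ν dX Rz : ℝ} {X : Finset Cube}
    (hloc : ∀ Z Z', ι Z' Z → ∃ q ∈ reach Z, q ∈ cubes Z')
    (hreach : ∀ Z, ((reach Z).card : ℝ) ≤ ν * (cubes Z).card)
    (hd : ∀ Z, 0 ≤ d Z) (hA : 0 ≤ A) (hK₀ : 0 ≤ K₀) (hc₁ : 0 ≤ c₁) (hν : 0 ≤ ν) (hκ₀ : 0 ≤ κ₀)
    (hr₁ : 0 ≤ r₁) (hc : 0 ≤ c) (hb : r₁ * c ≤ b) (hRz : 1 < Rz)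
    (hhol : ∀ Z, cubes Z ⊆ X → DifferentiableOn ℂ (fun z => w z Z) (ball (0 : ℂ) Rz))
    (hw : ∀ z : ℂ, ‖z‖ < Rz → ∀ Z, cubes Z ⊆ X → ‖w z Z‖ ≤ A * Real.exp (-(R * d Z)))
    (h126 : Ineq126 (Finset.univ : Finset Dom) cubes d κ₀ K₀)
    (hvol : VolBound (Finset.univ : Finset Dom) cubes d c₁)
    (h227 : Ineq227 (Finset.univ : Finset Dom) cubes d X dX c)
    (hrate : r₁ + 2 * κ₀ + 2 ≤ R) (hsmall : A * Real.exp (b + 1) * K₀ * ν * c₁ ≤ 1) (hX : X.Nonempty) :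
    ‖locE ι cubes (w 1) X - locE ι cubes (w 0) X‖ ≤
      (Real.exp 1 * ν * c₁ * K₀ ^ 2 * A * Real.exp (-(r₁ * dX))) / (Rz - 1) := by
  set τ : ℝ := A * Real.exp (b + 1) * K₀ * ν with hτ_def
  have hτ : 0 ≤ τ := by positivity
  have hτc : τ * c₁ ≤ 1 := hsmall
  have hsmall' : A * Real.exp (b + τ * c₁) * K₀ * ν ≤ τ := by
    have hexp : Real.exp (b + τ * c₁) ≤ Real.exp (b + 1) := Real.exp_le_exp.2 (by linarith)
    calc A * Real.exp (b + τ * c₁) * K₀ * ν ≤ A * Real.exp (b + 1) * K₀ * ν := by gcongr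
      _ = τ := rfl
  have h := norm_locE_sub_locE_le_of_pencil ι hloc hreach hd hA hK₀ hc₁ hτ hκ₀ hr₁ hc hb hRz hhol hw h126 hvol
    h227 (by linarith) hsmall' hX
  have hcancel : Real.exp (b + 1) * Real.exp (-b) = Real.exp 1 := by
    rw [← Real.exp_add]; congr 1; ring
  calc ‖locE ι cubes (w 1) X - locE ι cubes (w 0) X‖
      ≤ (τ * c₁ * K₀ * Real.exp (-b) * Real.exp (-(r₁ * dX))) / (Rz - 1) := h
    _ = ((Real.exp (b + 1) * Real.exp (-b)) * (ν * c₁ * K₀ ^ 2 * A * Real.exp (-(r₁ * dX)))) / (Rz - 1) := by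
        rw [hτ_def]; ring
    _ = (Real.exp 1 * ν * c₁ * K₀ ^ 2 * A * Real.exp (-(r₁ * dX))) / (Rz - 1) := by rw [hcancel]; ring

end PrintedLettersPencil

/-! ## §7. (v2) The reduction of `T4OutputRate.NE5` to a pencil: NE5 ⇐ NE5-REP ∧ NE5-PENCIL ∧ DECAY ∧ PIN ∧ BUDGET -/

namespace ClusterRep

variable {C : Carriers} (R : ClusterRep C)

/-- **NE5-PENCIL (HYPOTHESIS SHAPE — NOT PRINTED as a statement; asserted nowhere)**: on the window `W`, for every
run-B background `U` and domain `X`, the two runs' activity families in the step volume of `X` are the values at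
`z = 0` (run B) and `z = 1` (run A, transported background) of a PENCIL `z ↦ ρ g U z` of activity families which is
holomorphic on the disc `‖z‖ < Rz X` polymer by polymer and dominated there by a majorant `m` satisfying the
`d`-weighted Kotecký–Preiss hypothesis with size function `a` (`a, d ≥ 0`) — the ONE-run data of NE5-KP, with no
doubling.  Printed TYPE: B13 builds and bounds its activities `H(Z)` as analytic functions of complex parameters entering
the operators ((1.22)–(1.23) p. 7; (2.14) p. 15 *"We consider it as an analytic function of (𝐔, 𝐉) in the space
𝐔^c_{k+1}(X, α₀, α₁), and of the complex parameters σ(Z), τ"*; Lemma 3 (2.38) p. 20 bounds the activities so built); what is NOT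
PRINTED is Lemma 3 for activities whose INPUT operators (propagators, minimizers, fluctuation covariances at lattice
spacings η and η/L, cell NE2/NE3) are complex-interpolated between two runs — the cell's wall MI-A′ (PENCIL-MAJORANT).
[cite: Balaban1988RG2Cluster, (2.14) p.15 and Lemma 3 (2.38) p.20] -/
def PencilKP (W : Set (ℕ → ℝ)) (m : (ℕ → ℝ) → C.BgB → R.P → ℝ) (a d : R.P → ℝ)
    (ρ : (ℕ → ℝ) → C.BgB → ℂ → R.P → ℂ) (Rz : C.Dom → ℝ) : Prop :=
  (∀ γ, 0 ≤ a γ) ∧ (∀ γ, 0 ≤ d γ) ∧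
    ∀ g ∈ W, ∀ (U : C.BgB) (X : C.Dom),
      (∀ γ ∈ R.vol X, ρ g U 0 γ = R.ρB g U γ ∧ ρ g U 1 γ = R.ρA g U γ) ∧
      (∀ γ ∈ R.vol X, DifferentiableOn ℂ (fun z => ρ g U z γ) (ball (0 : ℂ) (Rz X))) ∧
      (∀ z : ℂ, ‖z‖ < Rz X → ∀ γ ∈ R.vol X, ‖ρ g U z γ‖ ≤ m g U γ) ∧
      (∀ γ ∈ R.vol X, ∑ γ' ∈ R.vol X with R.inc γ' γ, m g U γ' * Real.exp (a γ' + d γ') ≤ a γ)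

/-- **PENCIL BUDGET (HYPOTHESIS SHAPE — NOT PRINTED)**: the pencil radius pays the rate, `Rz X > 1` and
`1/(Rz X − 1) ≤ c θ^{scale X}`.  For an instantiation, `Rz X − 1` = (input analyticity margin of the step — printed
for ONE run: the conditions I.(i)–(iii) and the space 𝐔^c_{k+1}(X, α₀, α₁) of p. 15, with the g_j-dependent radii
α_{0,j}, α_{1,j} recorded in the tree as `B14.alphaJ` / the `T4OutputRate` §2 docstrings) ÷ (the two-run input
discrepancy at the scale of `X`, cell NE2 ∧ NE3 — NOT PRINTED): the cell's wall MI-A″ (PENCIL-RADIUS); the printed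
model of "radius = margin ÷ perturbation, gain 1/radius" is (1.22) p. 7 / (2.18) p. 16. [cite: Balaban1988RG2Cluster, (1.22) p.7 and (2.18) p.16] -/
def PencilBudget (θ c : ℝ) (Rz : C.Dom → ℝ) : Prop :=
  ∀ X, 1 < Rz X ∧ 1 ≤ c * θ ^ C.scale X * (Rz X - 1)

/-- **The (2.41)-shaped decay bound of run B's outputs from the pencil data** (kernel): NE5-REP ∧ NE5-PENCIL ∧ DECAY ∧
PIN BUDGET (radii positive) ⇒ `T4OutputRate.DecayBound EB W A κ` — the value `z = 0` of the pencil is under the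
majorant. [folklore] -/
theorem decayBound_of_pencil {EA : Functional C C.BgA} {EB : Functional C C.BgB} {W : Set (ℕ → ℝ)}
    {m : (ℕ → ℝ) → C.BgB → R.P → ℝ} {a d : R.P → ℝ} {ρ : (ℕ → ℝ) → C.BgB → ℂ → R.P → ℂ}
    {Rz δ : C.Dom → ℝ} {A κ : ℝ}
    (hrep : R.Represents EA EB) (hP : R.PencilKP W m a d ρ Rz) (hdec : R.DecayExtract δ d)
    (hpin : R.PinBudget a δ A κ) (hRz : ∀ X, 0 < Rz X) : DecayBound EB W A κ := by
  obtain ⟨ha, hd, hP'⟩ := hP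
  intro g hg U X
  obtain ⟨hend, -, hmaj, hkp⟩ := hP' g hg U X
  rw [hrep.2 g U X]
  have hB : ∀ γ ∈ R.vol X, ‖R.ρB g U γ‖ ≤ m g U γ := fun γ hγ => by
    rw [← (hend γ hγ).1]; exact hmaj 0 (by rw [norm_zero]; exact hRz X) γ hγ
  have hKPB : ∀ γ ∈ R.vol X,
      ∑ γ' ∈ R.vol X with R.inc γ' γ, ‖R.ρB g U γ'‖ * Real.exp (a γ' + d γ') ≤ a γ :=
    fun γ hγ => le_trans (Finset.sum_le_sum fun γ' hγ' =>
      mul_le_mul_of_nonneg_right (hB γ' (Finset.mem_filter.1 hγ').1) (Real.exp_nonneg _)) (hkp γ hγ)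
  have key := norm_clusterSum_le_of_kp ha hd hKPB (R.pin_mem X) (R.clus_sub X) (R.clus_pin X) (hdec X)
  calc |(R.outB g U X).re| ≤ ‖R.outB g U X‖ := Complex.abs_re_le_norm _
    _ ≤ a (R.pin X) * Real.exp (-(δ X)) := key
    _ ≤ A * Real.exp (-(κ * C.d X)) := hpin X

/-- **NE5 from a pencil** (kernel; v2 main reduction): NE5-REP ∧ NE5-PENCIL ∧ DECAY ∧ PIN BUDGET ∧ PENCIL BUDGET ⇒
`T4OutputRate.NE5 EA EB W κ θ (c A)` — the pencil form of the pinned activity-Lipschitz theorem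
(`norm_clusterSum_sub_le_of_family`) in the step volume of each `X`: `|E_A − E_B|(X) ≤ a(pin X) e^{−δ X}/(Rz X − 1) ≤
c θ^{scale X} A e^{−κ d(X)}`.  Compared with v1's `ne5_of_activityRate` (constant 4cA, KP for the doubled majorant) the
constant is cA and the KP hypothesis is the one-run one, because the interpolating family never leaves the one-run
majorant.  Every conditional of the cell ((B), (B^μ), BetaPertH-side windows) lives INSIDE `W`, NE5-PENCIL and the
budgets of whoever instantiates; nothing about Bałaban's functionals is asserted here. [folklore] -/
theorem ne5_of_pencil {EA : Functional C C.BgA} {EB : Functional C C.BgB} {W : Set (ℕ → ℝ)}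
    {m : (ℕ → ℝ) → C.BgB → R.P → ℝ} {a d : R.P → ℝ} {ρ : (ℕ → ℝ) → C.BgB → ℂ → R.P → ℂ}
    {Rz δ : C.Dom → ℝ} {A κ θ c : ℝ}
    (hrep : R.Represents EA EB) (hP : R.PencilKP W m a d ρ Rz) (hdec : R.DecayExtract δ d)
    (hpin : R.PinBudget a δ A κ) (hbud : PencilBudget θ c Rz) :
    NE5 EA EB W κ θ (c * A) := by
  obtain ⟨ha, hd, hP'⟩ := hP
  intro g hg U X
  obtain ⟨hend, hhol, hmaj, hkp⟩ := hP' g hg U X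
  obtain ⟨hRz, hb⟩ := hbud X
  -- the two outputs are the values of the pencil's cluster sums at `z = 1` and `z = 0`
  have hA1 : R.outA g U X = clusterSum R.inc (ρ g U 1) (R.clus X) :=
    clusterSum_congr fun K hK γ hγ => ((hend γ (R.clus_sub X K hK hγ)).2).symm
  have hB0 : R.outB g U X = clusterSum R.inc (ρ g U 0) (R.clus X) :=
    clusterSum_congr fun K hK γ hγ => ((hend γ (R.clus_sub X K hK hγ)).1).symm
  rw [hrep.1 g U X, hrep.2 g U X, ← Complex.sub_re, hA1, hB0]
  have hKPz : ∀ z : ℂ, ‖z‖ < Rz X → ∀ γ ∈ R.vol X,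
      ∑ γ' ∈ R.vol X with R.inc γ' γ, ‖ρ g U z γ'‖ * Real.exp (a γ' + d γ') ≤ a γ := by
    intro z hz γ hγ
    refine le_trans (Finset.sum_le_sum fun γ' hγ' => ?_) (hkp γ hγ)
    exact mul_le_mul_of_nonneg_right (hmaj z hz γ' (Finset.mem_filter.1 hγ').1) (Real.exp_nonneg _)
  have key := norm_clusterSum_sub_le_of_family (inc := R.inc) (w := fun z => ρ g U z) ha hd hRz hhol hKPz
    (R.pin_mem X) (R.clus_sub X) (R.clus_pin X) (hdec X)
  have henv : 0 ≤ A * Real.exp (-(κ * C.d X)) :=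
    le_trans (mul_nonneg (ha _) (Real.exp_nonneg _)) (hpin X)
  have hRz1 : 0 < Rz X - 1 := by linarith
  calc |(clusterSum R.inc (ρ g U 1) (R.clus X) - clusterSum R.inc (ρ g U 0) (R.clus X)).re|
      ≤ ‖clusterSum R.inc (ρ g U 1) (R.clus X) - clusterSum R.inc (ρ g U 0) (R.clus X)‖ :=
        Complex.abs_re_le_norm _
    _ ≤ a (R.pin X) / (Rz X - 1) * Real.exp (-(δ X)) := key
    _ = (a (R.pin X) * Real.exp (-(δ X))) / (Rz X - 1) := by ring
    _ ≤ (A * Real.exp (-(κ * C.d X))) / (Rz X - 1) := div_le_div_of_nonneg_right (hpin X) hRz1.le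
    _ ≤ c * θ ^ C.scale X * (A * Real.exp (-(κ * C.d X))) := by
        rw [div_le_iff₀ hRz1]
        calc A * Real.exp (-(κ * C.d X)) = 1 * (A * Real.exp (-(κ * C.d X))) := (one_mul _).symm
          _ ≤ (c * θ ^ C.scale X * (Rz X - 1)) * (A * Real.exp (-(κ * C.d X))) :=
              mul_le_mul_of_nonneg_right hb henv
          _ = c * θ ^ C.scale X * (A * Real.exp (-(κ * C.d X))) * (Rz X - 1) := by ring
    _ = c * A * θ ^ C.scale X * Real.exp (-(κ * C.d X)) := by ring

/-- **NE5-ACT from a pencil** (kernel): NE5-PENCIL ∧ PENCIL BUDGET ⇒ v1's `ActivityRate W m θ c` — polymer by polymer,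
the one-variable Cauchy bound `norm_sub_le_div_of_ball` gives `‖ρA − ρB‖ ≤ m/(Rz X − 1) ≤ c θ^{scale X} m`.  So the
v1 wall NE5-ACT (MI-A) is implied by the v2 data MI-A′ ∧ MI-A″; the converse route (an affine pencil of radius 1/ε under
the DOUBLED majorant) is v1's `touchDiffSum_le_of_majorant`. [folklore] -/
theorem activityRate_of_pencil {W : Set (ℕ → ℝ)} {m : (ℕ → ℝ) → C.BgB → R.P → ℝ} {a d : R.P → ℝ}
    {ρ : (ℕ → ℝ) → C.BgB → ℂ → R.P → ℂ} {Rz : C.Dom → ℝ} {θ c : ℝ}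
    (hP : R.PencilKP W m a d ρ Rz) (hbud : PencilBudget θ c Rz) : R.ActivityRate W m θ c := by
  obtain ⟨-, -, hP'⟩ := hP
  intro g hg U X γ hγ
  obtain ⟨hend, hhol, hmaj, -⟩ := hP' g hg U X
  obtain ⟨hRz, hb⟩ := hbud X
  have hRz1 : 0 < Rz X - 1 := by linarith
  have hm0 : 0 ≤ m g U γ := (norm_nonneg _).trans (hmaj 0 (by rw [norm_zero]; linarith) γ hγ)
  have key := norm_sub_le_div_of_ball (f := fun z => ρ g U z γ) hRz (hhol γ hγ) (fun z hz => hmaj z hz γ hγ)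
  rw [← (hend γ hγ).1, ← (hend γ hγ).2]
  calc ‖ρ g U 1 γ - ρ g U 0 γ‖ ≤ m g U γ / (Rz X - 1) := key
    _ ≤ c * θ ^ C.scale X * m g U γ := by
        rw [div_le_iff₀ hRz1]
        calc m g U γ = 1 * m g U γ := (one_mul _).symm
          _ ≤ (c * θ ^ C.scale X * (Rz X - 1)) * m g U γ := mul_le_mul_of_nonneg_right hb hm0
          _ = c * θ ^ C.scale X * m g U γ * (Rz X - 1) := by ring

end ClusterRep

/-! ## §8. (v3) INPUT pencils: the pencil data from input-analytic activities, the pencil radius COMPUTED from the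
input rate (the v2 wall MI-A″ discharged to kernel, modulo NE2 ∧ NE3 in margin units), and the one-parameter pencil
through a polydisc (max instead of sum)

Printed TYPE (one run): [I] p. 263 *"We assume that the function E^{(j)}(X, g_{j−1}, U, J) is defined and analytic on
the space U^c_j(X, α₀, α₁)"* with (1.18) there; B13 p. 15 *"We consider it as an analytic function of (𝐔, 𝐉) in the
space 𝐔^c_{k+1}(X, α₀, α₁), and of the complex parameters σ(Z), τ."* and Lemma 3 (2.38) p. 20 — activities holomorphic
in a complex neighbourhood of the INPUT with the majorant there.  NOT PRINTED: the same for the inputs that differ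
between two runs (propagators, minimizers, fluctuation covariances at two lattice spacings — cell NE2/NE3), and the size
of that discrepancy in units of the analyticity margin.  The theorems below are one-variable complex analysis and
bookkeeping over abstract normed input spaces; nothing about Bałaban's functionals is asserted. -/

section InputPencil

variable {E : Type*} [NormedAddCommGroup E] [NormedSpace ℂ E]

/-- The affine INPUT PENCIL through `pB` (`z = 0`) and `pA` (`z = 1`): `z ↦ pB + z • (pA − pB)` — Dimock's device
`E*(m₂ + t(m₁ − m₂))` ([Dimock2015], tree `Dimock2015.AnalyticLipschitz`) over an abstract complex normed space of
inputs (for group-valued inputs: coordinates of the PERTURBATION of run B's input, as in B13's own parametrisations of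
complex neighbourhoods, p. 15 𝐔^c_{k+1}(X, α₀, α₁)). [folklore] -/
def inputPencil (pA pB : E) (z : ℂ) : E := pB + z • (pA - pB)

/-- The pencil starts at run B's input. [folklore] -/
@[simp] theorem inputPencil_zero (pA pB : E) : inputPencil pA pB 0 = pB := by simp [inputPencil]

/-- The pencil reaches run A's input at `z = 1`. [folklore] -/
@[simp] theorem inputPencil_one (pA pB : E) : inputPencil pA pB 1 = pA := by simp [inputPencil]

/-- The input pencil is an entire (affine) function of the parameter. [folklore] -/
theorem differentiable_inputPencil (pA pB : E) : Differentiable ℂ (inputPencil pA pB) :=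
  (differentiable_const pB).add (differentiable_id.smul_const (pA - pB))

/-- RADIUS × DISCREPANCY ≤ MARGIN keeps the pencil inside the margin ball on the disc `‖z‖ < R` — the printed model is
(1.22) p. 7 (radius of the t_□-circle = ½α₂ ÷ the size of the perturbation). [folklore] -/
theorem inputPencil_mem_ball {pA pB : E} {ϱ R : ℝ} (hϱ : 0 < ϱ) (hfit : R * ‖pA - pB‖ ≤ ϱ) {z : ℂ}
    (hz : ‖z‖ < R) : inputPencil pA pB z ∈ ball pB ϱ := by
  rw [mem_ball, dist_eq_norm, inputPencil, add_sub_cancel_left, norm_smul]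
  rcases (norm_nonneg (pA - pB)).eq_or_lt with h | h
  · rw [← h, mul_zero]; exact hϱ
  · exact lt_of_lt_of_le (mul_lt_mul_of_pos_right hz h) hfit

/-- A function holomorphic on the margin ball is holomorphic along the pencil on the disc `‖z‖ < R`. [folklore] -/
theorem differentiableOn_comp_inputPencil {F : Type*} [NormedAddCommGroup F] [NormedSpace ℂ F] {Ψ : E → F}
    {pA pB : E} {ϱ R : ℝ} (hϱ : 0 < ϱ) (hfit : R * ‖pA - pB‖ ≤ ϱ) (hΨ : DifferentiableOn ℂ Ψ (ball pB ϱ)) :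
    DifferentiableOn ℂ (fun z : ℂ => Ψ (inputPencil pA pB z)) (ball (0 : ℂ) R) :=
  hΨ.comp (differentiable_inputPencil pA pB).differentiableOn fun _ hz =>
    inputPencil_mem_ball hϱ hfit (mem_ball_zero_iff.1 hz)

/-- **One-variable Cauchy bound through an input ball**: `Ψ` holomorphic on `ball pB ϱ` and bounded by `M` there,
`R‖pA − pB‖ ≤ ϱ`, `R > 1` ⇒ `‖Ψ pA − Ψ pB‖ ≤ M/(R − 1)` (§5 `norm_sub_le_div_of_ball` along the pencil). [folklore] -/
theorem norm_sub_le_div_of_inputBall {F : Type*} [NormedAddCommGroup F] [NormedSpace ℂ F] [CompleteSpace F]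
    {Ψ : E → F} {pA pB : E} {ϱ R M : ℝ} (hϱ : 0 < ϱ) (hR : 1 < R) (hfit : R * ‖pA - pB‖ ≤ ϱ)
    (hΨ : DifferentiableOn ℂ Ψ (ball pB ϱ)) (hM : ∀ p ∈ ball pB ϱ, ‖Ψ p‖ ≤ M) :
    ‖Ψ pA - Ψ pB‖ ≤ M / (R - 1) := by
  have key := norm_sub_le_div_of_ball (f := fun z : ℂ => Ψ (inputPencil pA pB z)) hR
    (differentiableOn_comp_inputPencil hϱ hfit hΨ) (fun z hz => hM _ (inputPencil_mem_ball hϱ hfit hz))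
  simpa using key

/-- **Relative form** (radius = 1/r): `‖pA − pB‖ ≤ rϱ` with `r ≤ ½` ⇒ `‖Ψ pA − Ψ pB‖ ≤ 2Mr` — discrepancy measured in
units of the margin, gain linear in it; the factor 2 is the price of using only half the margin, as in (1.22)'s ½α₂.
[folklore] -/
theorem norm_sub_le_of_inputBall {F : Type*} [NormedAddCommGroup F] [NormedSpace ℂ F] [CompleteSpace F]
    {Ψ : E → F} {pA pB : E} {ϱ r M : ℝ} (hϱ : 0 < ϱ) (hr : r ≤ 1 / 2) (hclose : ‖pA - pB‖ ≤ r * ϱ)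
    (hΨ : DifferentiableOn ℂ Ψ (ball pB ϱ)) (hM : ∀ p ∈ ball pB ϱ, ‖Ψ p‖ ≤ M) :
    ‖Ψ pA - Ψ pB‖ ≤ 2 * M * r := by
  have hM0 : 0 ≤ M := (norm_nonneg _).trans (hM pB (mem_ball_self hϱ))
  have hr0 : 0 ≤ r := by
    by_contra hneg
    have : r * ϱ < 0 := mul_neg_of_neg_of_pos (not_le.1 hneg) hϱ
    linarith [norm_nonneg (pA - pB)]
  rcases hr0.eq_or_lt with h | h
  · have hAB : pA = pB := by
      refine sub_eq_zero.1 (norm_le_zero_iff.1 ?_)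
      simpa [← h] using hclose
    rw [hAB, sub_self, norm_zero, ← h, mul_zero]
  · have hR : 1 < r⁻¹ := (one_lt_inv₀ h).2 (by linarith)
    have hfit : r⁻¹ * ‖pA - pB‖ ≤ ϱ := by
      rw [inv_mul_le_iff₀ h]; exact hclose
    have h2 : (2 : ℝ) ≤ r⁻¹ := by
      rw [le_inv_comm₀ two_pos h]; linarith
    calc ‖Ψ pA - Ψ pB‖ ≤ M / (r⁻¹ - 1) := norm_sub_le_div_of_inputBall hϱ hR hfit hΨ hM
      _ ≤ M / (r⁻¹ / 2) := div_le_div_of_nonneg_left hM0 (by positivity) (by linarith)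
      _ = 2 * M * r := by rw [div_div_eq_mul_div, div_inv_eq_mul]; ring

end InputPencil

/-! ### §8b. The one-parameter pencil through a POLYDISC: max instead of sum

For the sibling leaf `T4InputCauchyRate` (P1), whose `norm_sub_le_sum_of_polydisc` runs Cauchy block by block along a
staircase and pays `Σ_i (2M/ϱ_i)‖x_i − y_i‖`: one complex parameter through all blocks at once pays
`2M · max_i ‖x_i − y_i‖/ϱ_i` — never more, and smaller by up to the number of blocks.  Stated over the explicit set
`{p | ∀ i, ‖p i − y i‖ ≤ ϱ i}` (= `T4InputCauchyRate.polydisc y ϱ` by `rfl`), so no import is needed. -/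

section PolydiscPencil

variable {P F : Type*} [NormedAddCommGroup P] [NormedSpace ℂ P] [NormedAddCommGroup F] [NormedSpace ℂ F]

/-- The pencil through `y` (z = 0) and `x` (z = 1) stays in the closed polydisc about `y` on the disc `‖z‖ < R` once
`‖x_i − y_i‖ ≤ rϱ_i` blockwise and `Rr ≤ 1`. [folklore] -/
theorem inputPencil_mem_polydisc {n : ℕ} {x y : Fin n → P} {ϱ : Fin n → ℝ} {r R : ℝ} (hRr : R * r ≤ 1)
    (hϱ : ∀ i, 0 ≤ ϱ i) (hx : ∀ i, ‖x i - y i‖ ≤ r * ϱ i) {z : ℂ} (hz : ‖z‖ < R) :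
    inputPencil x y z ∈ {p : Fin n → P | ∀ i, ‖p i - y i‖ ≤ ϱ i} := by
  intro i
  simp only [inputPencil, Pi.add_apply, Pi.smul_apply, Pi.sub_apply, add_sub_cancel_left, norm_smul]
  calc ‖z‖ * ‖x i - y i‖ ≤ R * (r * ϱ i) := mul_le_mul hz.le (hx i) (norm_nonneg _) ((norm_nonneg z).trans hz.le)
    _ = (R * r) * ϱ i := by ring
    _ ≤ 1 * ϱ i := mul_le_mul_of_nonneg_right hRr (hϱ i)
    _ = ϱ i := one_mul _

/-- **Cauchy through a polydisc along ONE pencil — max instead of sum**: `Φ` holomorphic on the closed polydisc about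
`y` with polyradius `ϱ > 0` and bounded by `M` there, `‖x_i − y_i‖ ≤ rϱ_i` for every block with `0 ≤ r ≤ ½` ⇒
`‖Φ x − Φ y‖ ≤ 2Mr`.  With `r = max_i ‖x_i − y_i‖/ϱ_i` this is `2M · max_i(‖x_i − y_i‖/ϱ_i)`, to be compared with the
staircase bound `Σ_i (2M/ϱ_i)‖x_i − y_i‖` of `T4InputCauchyRate.norm_sub_le_sum_of_polydisc` (same hypotheses; the set
below is its `polydisc y ϱ` by `rfl`).  For P1's recursion this replaces `Σ_{j<k}` by `max_{j<k}` in the history part.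
[folklore] -/
theorem norm_sub_le_of_polydisc_pencil [CompleteSpace F] {n : ℕ} {Φ : (Fin n → P) → F} {x y : Fin n → P}
    {ϱ : Fin n → ℝ} {M r : ℝ} (hϱ : ∀ i, 0 < ϱ i)
    (hΦ : DifferentiableOn ℂ Φ {p : Fin n → P | ∀ i, ‖p i - y i‖ ≤ ϱ i})
    (hM : ∀ p ∈ {p : Fin n → P | ∀ i, ‖p i - y i‖ ≤ ϱ i}, ‖Φ p‖ ≤ M) (hr0 : 0 ≤ r) (hr : r ≤ 1 / 2)
    (hx : ∀ i, ‖x i - y i‖ ≤ r * ϱ i) : ‖Φ x - Φ y‖ ≤ 2 * M * r := by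
  have hy : y ∈ {p : Fin n → P | ∀ i, ‖p i - y i‖ ≤ ϱ i} := fun i => by simpa using (hϱ i).le
  have hM0 : 0 ≤ M := (norm_nonneg _).trans (hM y hy)
  rcases hr0.eq_or_lt with h | h
  · have hxy : x = y := funext fun i => sub_eq_zero.1 (norm_le_zero_iff.1 (by simpa [← h] using hx i))
    rw [hxy, sub_self, norm_zero, ← h, mul_zero]
  · have hR : 1 < r⁻¹ := (one_lt_inv₀ h).2 (by linarith)
    have hmaps : ∀ z : ℂ, ‖z‖ < r⁻¹ → inputPencil x y z ∈ {p : Fin n → P | ∀ i, ‖p i - y i‖ ≤ ϱ i} :=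
      fun z hz => inputPencil_mem_polydisc (by rw [inv_mul_cancel₀ h.ne']) (fun i => (hϱ i).le) hx hz
    have hdiff : DifferentiableOn ℂ (fun z : ℂ => Φ (inputPencil x y z)) (ball (0 : ℂ) r⁻¹) :=
      hΦ.comp (differentiable_inputPencil x y).differentiableOn fun z hz => hmaps z (mem_ball_zero_iff.1 hz)
    have key := norm_sub_le_div_of_ball hR hdiff (fun z hz => hM _ (hmaps z hz))
    simp only [inputPencil_one, inputPencil_zero] at key
    have h2 : (2 : ℝ) ≤ r⁻¹ := by
      rw [le_inv_comm₀ two_pos h]; linarith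
    calc ‖Φ x - Φ y‖ ≤ M / (r⁻¹ - 1) := key
      _ ≤ M / (r⁻¹ / 2) := div_le_div_of_nonneg_left hM0 (by positivity) (by linarith)
      _ = 2 * M * r := by rw [div_div_eq_mul_div, div_inv_eq_mul]; ring

end PolydiscPencil

/-! ### §8c. Over the carriers: LOCAL pencils, INPUT-KP, INPUT RATE, and NE5 with the radius computed -/

namespace ClusterRep

variable {C : Carriers} (R : ClusterRep C)

/-- **NE5-PENCIL, LOCAL form (HYPOTHESIS SHAPE — NOT PRINTED; asserted nowhere)**: as `PencilKP`, but the pencil of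
activity families may depend on the domain `X` — pencils through LOCALISED inputs do (the input discrepancy relevant to
`X` and the margin are read at the scale of `X`).  `PencilKP` is the `X`-uniform special case
(`localPencilKP_of_pencilKP`). [cite: Balaban1988RG2Cluster, (2.14) p.15 and Lemma 3 (2.38) p.20] -/
def LocalPencilKP (W : Set (ℕ → ℝ)) (m : (ℕ → ℝ) → C.BgB → R.P → ℝ) (a d : R.P → ℝ)
    (ρ : (ℕ → ℝ) → C.BgB → C.Dom → ℂ → R.P → ℂ) (Rz : C.Dom → ℝ) : Prop :=
  (∀ γ, 0 ≤ a γ) ∧ (∀ γ, 0 ≤ d γ) ∧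
    ∀ g ∈ W, ∀ (U : C.BgB) (X : C.Dom),
      (∀ γ ∈ R.vol X, ρ g U X 0 γ = R.ρB g U γ ∧ ρ g U X 1 γ = R.ρA g U γ) ∧
      (∀ γ ∈ R.vol X, DifferentiableOn ℂ (fun z => ρ g U X z γ) (ball (0 : ℂ) (Rz X))) ∧
      (∀ z : ℂ, ‖z‖ < Rz X → ∀ γ ∈ R.vol X, ‖ρ g U X z γ‖ ≤ m g U γ) ∧
      (∀ γ ∈ R.vol X, ∑ γ' ∈ R.vol X with R.inc γ' γ, m g U γ' * Real.exp (a γ' + d γ') ≤ a γ)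

/-- A (global) pencil is a local pencil. [folklore] -/
theorem localPencilKP_of_pencilKP {W : Set (ℕ → ℝ)} {m : (ℕ → ℝ) → C.BgB → R.P → ℝ} {a d : R.P → ℝ}
    {ρ : (ℕ → ℝ) → C.BgB → ℂ → R.P → ℂ} {Rz : C.Dom → ℝ} (hP : R.PencilKP W m a d ρ Rz) :
    R.LocalPencilKP W m a d (fun g U _ => ρ g U) Rz := by
  obtain ⟨ha, hd, h⟩ := hP
  exact ⟨ha, hd, fun g hg U X => h g hg U X⟩

/-- **NE5 from a local pencil** (kernel; `ne5_of_pencil` verbatim with an `X`-dependent pencil):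
NE5-REP ∧ LOCAL-PENCIL ∧ DECAY ∧ PIN ∧ PENCIL-BUDGET ⇒ `T4OutputRate.NE5 EA EB W κ θ (cA)`. [folklore] -/
theorem ne5_of_localPencil {EA : Functional C C.BgA} {EB : Functional C C.BgB} {W : Set (ℕ → ℝ)}
    {m : (ℕ → ℝ) → C.BgB → R.P → ℝ} {a d : R.P → ℝ} {ρ : (ℕ → ℝ) → C.BgB → C.Dom → ℂ → R.P → ℂ}
    {Rz δ : C.Dom → ℝ} {A κ θ c : ℝ}
    (hrep : R.Represents EA EB) (hP : R.LocalPencilKP W m a d ρ Rz) (hdec : R.DecayExtract δ d)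
    (hpin : R.PinBudget a δ A κ) (hbud : PencilBudget θ c Rz) :
    NE5 EA EB W κ θ (c * A) := by
  obtain ⟨ha, hd, hP'⟩ := hP
  intro g hg U X
  obtain ⟨hend, hhol, hmaj, hkp⟩ := hP' g hg U X
  obtain ⟨hRz, hb⟩ := hbud X
  have hA1 : R.outA g U X = clusterSum R.inc (ρ g U X 1) (R.clus X) :=
    clusterSum_congr fun K hK γ hγ => ((hend γ (R.clus_sub X K hK hγ)).2).symm
  have hB0 : R.outB g U X = clusterSum R.inc (ρ g U X 0) (R.clus X) :=
    clusterSum_congr fun K hK γ hγ => ((hend γ (R.clus_sub X K hK hγ)).1).symm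
  rw [hrep.1 g U X, hrep.2 g U X, ← Complex.sub_re, hA1, hB0]
  have hKPz : ∀ z : ℂ, ‖z‖ < Rz X → ∀ γ ∈ R.vol X,
      ∑ γ' ∈ R.vol X with R.inc γ' γ, ‖ρ g U X z γ'‖ * Real.exp (a γ' + d γ') ≤ a γ := by
    intro z hz γ hγ
    refine le_trans (Finset.sum_le_sum fun γ' hγ' => ?_) (hkp γ hγ)
    exact mul_le_mul_of_nonneg_right (hmaj z hz γ' (Finset.mem_filter.1 hγ').1) (Real.exp_nonneg _)
  have key := norm_clusterSum_sub_le_of_family (inc := R.inc) (w := fun z => ρ g U X z) ha hd hRz hhol hKPz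
    (R.pin_mem X) (R.clus_sub X) (R.clus_pin X) (hdec X)
  have henv : 0 ≤ A * Real.exp (-(κ * C.d X)) :=
    le_trans (mul_nonneg (ha _) (Real.exp_nonneg _)) (hpin X)
  have hRz1 : 0 < Rz X - 1 := by linarith
  calc |(clusterSum R.inc (ρ g U X 1) (R.clus X) - clusterSum R.inc (ρ g U X 0) (R.clus X)).re|
      ≤ ‖clusterSum R.inc (ρ g U X 1) (R.clus X) - clusterSum R.inc (ρ g U X 0) (R.clus X)‖ :=
        Complex.abs_re_le_norm _
    _ ≤ a (R.pin X) / (Rz X - 1) * Real.exp (-(δ X)) := key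
    _ = (a (R.pin X) * Real.exp (-(δ X))) / (Rz X - 1) := by ring
    _ ≤ (A * Real.exp (-(κ * C.d X))) / (Rz X - 1) := div_le_div_of_nonneg_right (hpin X) hRz1.le
    _ ≤ c * θ ^ C.scale X * (A * Real.exp (-(κ * C.d X))) := by
        rw [div_le_iff₀ hRz1]
        calc A * Real.exp (-(κ * C.d X)) = 1 * (A * Real.exp (-(κ * C.d X))) := (one_mul _).symm
          _ ≤ (c * θ ^ C.scale X * (Rz X - 1)) * (A * Real.exp (-(κ * C.d X))) :=
              mul_le_mul_of_nonneg_right hb henv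
          _ = c * θ ^ C.scale X * (A * Real.exp (-(κ * C.d X))) * (Rz X - 1) := by ring
    _ = c * A * θ ^ C.scale X * Real.exp (-(κ * C.d X)) := by ring

/-- **NE5-ACT from a local pencil** (kernel; `activityRate_of_pencil` verbatim). [folklore] -/
theorem activityRate_of_localPencil {W : Set (ℕ → ℝ)} {m : (ℕ → ℝ) → C.BgB → R.P → ℝ} {a d : R.P → ℝ}
    {ρ : (ℕ → ℝ) → C.BgB → C.Dom → ℂ → R.P → ℂ} {Rz : C.Dom → ℝ} {θ c : ℝ}
    (hP : R.LocalPencilKP W m a d ρ Rz) (hbud : PencilBudget θ c Rz) : R.ActivityRate W m θ c := by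
  obtain ⟨-, -, hP'⟩ := hP
  intro g hg U X γ hγ
  obtain ⟨hend, hhol, hmaj, -⟩ := hP' g hg U X
  obtain ⟨hRz, hb⟩ := hbud X
  have hRz1 : 0 < Rz X - 1 := by linarith
  have hm0 : 0 ≤ m g U γ := (norm_nonneg _).trans (hmaj 0 (by rw [norm_zero]; linarith) γ hγ)
  have key := norm_sub_le_div_of_ball (f := fun z => ρ g U X z γ) hRz (hhol γ hγ) (fun z hz => hmaj z hz γ hγ)
  rw [← (hend γ hγ).1, ← (hend γ hγ).2]
  calc ‖ρ g U X 1 γ - ρ g U X 0 γ‖ ≤ m g U γ / (Rz X - 1) := key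
    _ ≤ c * θ ^ C.scale X * m g U γ := by
        rw [div_le_iff₀ hRz1]
        calc m g U γ = 1 * m g U γ := (one_mul _).symm
          _ ≤ (c * θ ^ C.scale X * (Rz X - 1)) * m g U γ := mul_le_mul_of_nonneg_right hb hm0
          _ = c * θ ^ C.scale X * m g U γ * (Rz X - 1) := by ring

/-- **INPUT-KP (HYPOTHESIS SHAPE — "Lemma 3 on a complex neighbourhood of the two-run inputs"; NOT PRINTED as a
statement; asserted nowhere)**: on the window `W`, for every run-B background `U` and domain `X` there is a complex
normed space `E X` of (perturbations of) the INPUTS read at the scale of `X`, the two runs' inputs `pA g U X`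
(run A, transported background) and `pB g U X`, and for every polymer `γ` of the step volume an activity FUNCTION
`Ψ g U X γ : E X → ℂ` taking the value `ρB g U γ` at `pB` and `ρA g U γ` at `pA`, holomorphic on the margin ball
`ball (pB g U X) (ϱ X)` and dominated there by the ONE-run majorant `m` (KP for `m` with size `a`, weights `d`).
Printed TYPE: [I] p. 263 (analytic on U^c_j(X, α₀, α₁) with (1.18)); B13 p. 15 (*"analytic function of (𝐔, 𝐉) in
the space 𝐔^c_{k+1}(X, α₀, α₁)"*) and Lemma 3 (2.38) p. 20 — for the BACKGROUND input, one run.  NOT PRINTED: the same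
in the inputs that differ between the runs (cell NE2/NE3); this is the analytic half MI-A′ of the wall, in input form.
[cite: Balaban1988RG2Cluster, (2.14) p.15 and Lemma 3 (2.38) p.20] -/
def InputKP (W : Set (ℕ → ℝ)) (m : (ℕ → ℝ) → C.BgB → R.P → ℝ) (a d : R.P → ℝ)
    {E : C.Dom → Type*} [∀ X, NormedAddCommGroup (E X)] [∀ X, NormedSpace ℂ (E X)]
    (Ψ : (ℕ → ℝ) → C.BgB → (X : C.Dom) → R.P → E X → ℂ) (pA pB : (ℕ → ℝ) → C.BgB → (X : C.Dom) → E X)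
    (ϱ : C.Dom → ℝ) : Prop :=
  (∀ γ, 0 ≤ a γ) ∧ (∀ γ, 0 ≤ d γ) ∧ (∀ X, 0 < ϱ X) ∧
    ∀ g ∈ W, ∀ (U : C.BgB) (X : C.Dom),
      (∀ γ ∈ R.vol X, Ψ g U X γ (pB g U X) = R.ρB g U γ ∧ Ψ g U X γ (pA g U X) = R.ρA g U γ) ∧
      (∀ γ ∈ R.vol X, DifferentiableOn ℂ (Ψ g U X γ) (ball (pB g U X) (ϱ X))) ∧
      (∀ p ∈ ball (pB g U X) (ϱ X), ∀ γ ∈ R.vol X, ‖Ψ g U X γ p‖ ≤ m g U γ) ∧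
      (∀ γ ∈ R.vol X, ∑ γ' ∈ R.vol X with R.inc γ' γ, m g U γ' * Real.exp (a γ' + d γ') ≤ a γ)

/-- **INPUT RATE in margin units (HYPOTHESIS SHAPE = the cell's NE2 ∧ NE3 read at the scale of `X`; NOT PRINTED)**:
the two runs' inputs for `X` differ by at most `Dθ^{scale X}` margins.  Printed MODELS of such a rate (other settings):
[King1986] Prop. 3.8/3.9; none in [Bałaban 1983–89].  CAVEAT (v3.1; the sibling seat t4-ne5-p1's caution, cell
journal l.48012, adopted by the carver in `t4/T4-DAG.md` v17 §6 NE5): for the flow of B12–B14 the input point of a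
step-`k` activity also carries the COUPLING HISTORY `(g_0, …, g_{k−1})`, and the two runs' histories differ by the
accumulated OUTPUT discrepancies of the earlier steps (memory-weighted `Σ_{j<k} ω^{k−j}·NE5_j`) — a quantity of the
same kind as NE5 itself.  A constant-`D` `InputRate` for the WHOLE input point is therefore honest only for the
operator / background part of the inputs (NE2 ∧ NE3), or after the history recursion has been summed elsewhere; the
history-honest activity-level form (history entering through fixed insertion maps of the output tables, damped, and
closing through the sibling's recursive budget `T4InputCauchyRate.RecursiveRate` / `ne5_of_recursiveRate`) is this
lineage's gen-3 successor leaf, not this file.  Nothing in the kernel content below changes: `ne5_of_inputKP` is and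
was a correct implication from its displayed hypotheses. [cite: Balaban1988RG2Cluster, (1.22) p.7] -/
def InputRate (W : Set (ℕ → ℝ)) {E : C.Dom → Type*} [∀ X, NormedAddCommGroup (E X)]
    (pA pB : (ℕ → ℝ) → C.BgB → (X : C.Dom) → E X) (ϱ : C.Dom → ℝ) (θ D : ℝ) : Prop :=
  ∀ g ∈ W, ∀ (U : C.BgB) (X : C.Dom), ‖pA g U X - pB g U X‖ ≤ D * θ ^ C.scale X * ϱ X

/-- **INPUT-KP ∧ INPUT RATE ⇒ LOCAL PENCIL with radius `(Dθ^{scale X})⁻¹`** (kernel): the affine input pencil through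
`pB g U X` and `pA g U X` stays in the margin ball on the disc of radius margin ÷ discrepancy, the activities along it
are holomorphic there and under the one-run majorant. [folklore] -/
theorem localPencilKP_of_inputKP {W : Set (ℕ → ℝ)} {m : (ℕ → ℝ) → C.BgB → R.P → ℝ} {a d : R.P → ℝ}
    {E : C.Dom → Type*} [∀ X, NormedAddCommGroup (E X)] [∀ X, NormedSpace ℂ (E X)]
    {Ψ : (ℕ → ℝ) → C.BgB → (X : C.Dom) → R.P → E X → ℂ} {pA pB : (ℕ → ℝ) → C.BgB → (X : C.Dom) → E X}
    {ϱ : C.Dom → ℝ} {θ D : ℝ} (hI : R.InputKP W m a d Ψ pA pB ϱ) (hrate : InputRate W pA pB ϱ θ D)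
    (hD : 0 < D) (hθ : 0 < θ) :
    R.LocalPencilKP W m a d (fun g U X z γ => Ψ g U X γ (inputPencil (pA g U X) (pB g U X) z))
      (fun X => (D * θ ^ C.scale X)⁻¹) := by
  obtain ⟨ha, hd, hϱ, hI'⟩ := hI
  refine ⟨ha, hd, fun g hg U X => ?_⟩
  obtain ⟨hend, hhol, hmaj, hkp⟩ := hI' g hg U X
  have hr0 : 0 < D * θ ^ C.scale X := mul_pos hD (pow_pos hθ _)
  have hfit : (D * θ ^ C.scale X)⁻¹ * ‖pA g U X - pB g U X‖ ≤ ϱ X := by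
    rw [inv_mul_le_iff₀ hr0]; exact hrate g hg U X
  refine ⟨fun γ hγ => ?_, fun γ hγ => ?_, fun z hz γ hγ => ?_, hkp⟩
  · simp only [inputPencil_zero, inputPencil_one]; exact hend γ hγ
  · exact differentiableOn_comp_inputPencil (hϱ X) hfit (hhol γ hγ)
  · exact hmaj _ (inputPencil_mem_ball (hϱ X) hfit hz) γ hγ

/-- **The pencil radius pays the rate** (kernel; the v2 wall MI-A″ in its abstract form): inside the window
`Dθ^{scale X} ≤ ½` the radius `(Dθ^{scale X})⁻¹` satisfies `PencilBudget θ (2D)`. [folklore] -/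
theorem pencilBudget_of_window {θ D : ℝ} (hwin : ∀ X : C.Dom, D * θ ^ C.scale X ≤ 1 / 2) (hD : 0 < D)
    (hθ : 0 < θ) : PencilBudget (C := C) θ (2 * D) (fun X => (D * θ ^ C.scale X)⁻¹) := by
  intro X
  have hr0 : 0 < D * θ ^ C.scale X := mul_pos hD (pow_pos hθ _)
  have h2 : (2 : ℝ) ≤ (D * θ ^ C.scale X)⁻¹ := by
    rw [le_inv_comm₀ two_pos hr0]; linarith [hwin X]
  refine ⟨by linarith, ?_⟩
  have hid : 2 * D * θ ^ C.scale X * ((D * θ ^ C.scale X)⁻¹ - 1) = 2 - 2 * (D * θ ^ C.scale X) := by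
    have hne : D * θ ^ C.scale X ≠ 0 := hr0.ne'
    calc 2 * D * θ ^ C.scale X * ((D * θ ^ C.scale X)⁻¹ - 1)
        = 2 * ((D * θ ^ C.scale X) * (D * θ ^ C.scale X)⁻¹) - 2 * (D * θ ^ C.scale X) := by ring
      _ = 2 - 2 * (D * θ ^ C.scale X) := by rw [mul_inv_cancel₀ hne]; ring
  rw [hid]
  linarith [hwin X]

/-- **NE5 FROM INPUT-ANALYTIC ACTIVITIES AND THE INPUT RATE** (kernel; v3 main reduction):
NE5-REP ∧ INPUT-KP ∧ INPUT-RATE(θ, D) ∧ window `Dθ^{scale} ≤ ½` ∧ DECAY ∧ PIN ⇒ `T4OutputRate.NE5 EA EB W κ θ (2DA)`.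
The pencil radius is COMPUTED (margin ÷ discrepancy), so of the v2 wall only the analytic half survives as a hypothesis
(INPUT-KP = MI-A′ in input form) next to the input rate itself (NE2 ∧ NE3 in margin units); constants: one-run KP, one-run
envelope `A`, factor `2D` from half the margin.  (B), (B^μ), BetaPertH and the ε₁/κ windows are hypotheses of Lemma 3,
hence of INPUT-KP, for whoever instantiates — by name; the g_j-dependence of the margins ([III] (2.28), tree
`B14.alphaJ`) sits in `ϱ`, and the input rate is measured against it. [folklore] -/
theorem ne5_of_inputKP {EA : Functional C C.BgA} {EB : Functional C C.BgB} {W : Set (ℕ → ℝ)}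
    {m : (ℕ → ℝ) → C.BgB → R.P → ℝ} {a d : R.P → ℝ}
    {E : C.Dom → Type*} [∀ X, NormedAddCommGroup (E X)] [∀ X, NormedSpace ℂ (E X)]
    {Ψ : (ℕ → ℝ) → C.BgB → (X : C.Dom) → R.P → E X → ℂ} {pA pB : (ℕ → ℝ) → C.BgB → (X : C.Dom) → E X}
    {ϱ δ : C.Dom → ℝ} {A κ θ D : ℝ}
    (hrep : R.Represents EA EB) (hI : R.InputKP W m a d Ψ pA pB ϱ) (hrate : InputRate W pA pB ϱ θ D)
    (hwin : ∀ X : C.Dom, D * θ ^ C.scale X ≤ 1 / 2) (hD : 0 < D) (hθ : 0 < θ)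
    (hdec : R.DecayExtract δ d) (hpin : R.PinBudget a δ A κ) : NE5 EA EB W κ θ (2 * D * A) :=
  R.ne5_of_localPencil hrep (R.localPencilKP_of_inputKP hI hrate hD hθ) hdec hpin (pencilBudget_of_window hwin hD hθ)

/-- **NE5-ACT from input-analytic activities** (kernel): the same data give v1's `ActivityRate W m θ (2D)` polymer by
polymer. [folklore] -/
theorem activityRate_of_inputKP {W : Set (ℕ → ℝ)} {m : (ℕ → ℝ) → C.BgB → R.P → ℝ} {a d : R.P → ℝ}
    {E : C.Dom → Type*} [∀ X, NormedAddCommGroup (E X)] [∀ X, NormedSpace ℂ (E X)]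
    {Ψ : (ℕ → ℝ) → C.BgB → (X : C.Dom) → R.P → E X → ℂ} {pA pB : (ℕ → ℝ) → C.BgB → (X : C.Dom) → E X}
    {ϱ : C.Dom → ℝ} {θ D : ℝ} (hI : R.InputKP W m a d Ψ pA pB ϱ) (hrate : InputRate W pA pB ϱ θ D)
    (hwin : ∀ X : C.Dom, D * θ ^ C.scale X ≤ 1 / 2) (hD : 0 < D) (hθ : 0 < θ) :
    R.ActivityRate W m θ (2 * D) :=
  R.activityRate_of_localPencil (R.localPencilKP_of_inputKP hI hrate hD hθ) (pencilBudget_of_window hwin hD hθ)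

/-- **Decay bound of run B's outputs from the input data** (kernel): INPUT-KP's value at `pB` is under the majorant.
[folklore] -/
theorem decayBound_of_inputKP {EA : Functional C C.BgA} {EB : Functional C C.BgB} {W : Set (ℕ → ℝ)}
    {m : (ℕ → ℝ) → C.BgB → R.P → ℝ} {a d : R.P → ℝ}
    {E : C.Dom → Type*} [∀ X, NormedAddCommGroup (E X)] [∀ X, NormedSpace ℂ (E X)]
    {Ψ : (ℕ → ℝ) → C.BgB → (X : C.Dom) → R.P → E X → ℂ} {pA pB : (ℕ → ℝ) → C.BgB → (X : C.Dom) → E X}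
    {ϱ δ : C.Dom → ℝ} {A κ : ℝ}
    (hrep : R.Represents EA EB) (hI : R.InputKP W m a d Ψ pA pB ϱ) (hdec : R.DecayExtract δ d)
    (hpin : R.PinBudget a δ A κ) : DecayBound EB W A κ := by
  obtain ⟨ha, hd, hϱ, hI'⟩ := hI
  intro g hg U X
  obtain ⟨hend, -, hmaj, hkp⟩ := hI' g hg U X
  rw [hrep.2 g U X]
  have hB : ∀ γ ∈ R.vol X, ‖R.ρB g U γ‖ ≤ m g U γ := fun γ hγ => by
    rw [← (hend γ hγ).1]; exact hmaj _ (mem_ball_self (hϱ X)) γ hγ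
  have hKPB : ∀ γ ∈ R.vol X,
      ∑ γ' ∈ R.vol X with R.inc γ' γ, ‖R.ρB g U γ'‖ * Real.exp (a γ' + d γ') ≤ a γ :=
    fun γ hγ => le_trans (Finset.sum_le_sum fun γ' hγ' =>
      mul_le_mul_of_nonneg_right (hB γ' (Finset.mem_filter.1 hγ').1) (Real.exp_nonneg _)) (hkp γ hγ)
  have key := norm_clusterSum_le_of_kp ha hd hKPB (R.pin_mem X) (R.clus_sub X) (R.clus_pin X) (hdec X)
  calc |(R.outB g U X).re| ≤ ‖R.outB g U X‖ := Complex.abs_re_le_norm _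
    _ ≤ a (R.pin X) * Real.exp (-(δ X)) := key
    _ ≤ A * Real.exp (-(κ * C.d X)) := hpin X

end ClusterRep


end Literature.MathematicalPhysics.QuantumFieldTheory.Balaban1983to89.T4ActivityLipschitz

end
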